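import Literature.Computability.Cryptography.ChenQuantumLWEDatumPrivacySharp

/-!
# The exact optimum of the datum read-out of Chen's Step-9 register, every `Q` (T13)

REPRODUCTION / ANALYSIS OF A CLAIMED RESULT UNDER ADJUDICATION (withdrawn): Yilei Chen, *Quantum
Algorithms for Lattice Problems*, IACR ePrint 2024/555, version of 2024-04-18 [ChenQuantumLattice2024]
(the version carrying the author's note that Step 9 contains a bug), Step 9 (§3.5.9, pp. 34–38) acting
on `|φ8.b⟩ = Σ_{j ∈ ℤ_P} e(-j²/P) |2D²j·b + v′ mod N⟩` (p. 35), `P = p₁Q`, `N = D²P`.  Bundle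
`papers/QuantumAdvantage/lwe-quantum-autopsy/`, Part 2 (`REPAIR-CENSUS.md` §1 theorem **T13** and §20),
on top of `ChenQuantumLWEDatumPrivacy.lean` (T10: the class model `datumKet`, `datumGram` and its closed
form on the annihilator) and `ChenQuantumLWEDatumPrivacySharp.lean` (T12: `spanProj`, `datumKet_normSq`).
HONEST FRAMING: kernel-checked THEOREMS about a state occurring in a WITHDRAWN algorithm — here the
EXACT VALUE, for EVERY modulus `Q`, of an information quantity (how well ANY measurement of the register
Step 9 receives can read the datum Step 9 consumes), i.e. a decidable verdict completing a precise
NEGATIVE result; NOT summit progress, no cryptanalytic claim in either direction, no new algorithm for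
any lattice problem; quantum lower bounds are out of scope.

## The question

T10 (`datum_success_prob_le`) bounds, and T12 (`datum_success_prob_isGreatest_of_prime`) determines FOR
PRIME `Q`, the best probability with which a measurement (POVM) of the Step-9 register `ℤ_N^{n+1}` guesses
the datum `a ∈ ℤ_Q` in the class model of one run (secrets `b + 2p₁(s·𝟙_U)`, offsets `v′ + d(a,c)`):
`1/Q + (1 − 1/Q)/Q^m`, `m = #U`.  But in Chen's algorithm `Q` is NEVER prime: with `P = p₁Q = M/(2D²)`,
`M = 2(c+1)‖b‖²D²` (Cond. C.3–C.5, p. 18), `Q = (c+1)‖b‖²/p₁` is a product of two factors `> 1`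
(`Shape.Admissible` only asks `Q` odd, `≥ 3`, coprime to `D` and `p₁`).  For composite `Q` the tree so
far only BRACKETS the optimum: T12's read-out attains `1/Q + (1 − 1/Q)/Q^m`, T10 allows
`1/Q + (1 − 1/Q)·((Q − φ-like)/Q)^m`, and the true value (`(1/Q)·E_u[gcd(ū|_U, Q)]` by hand, census §17)
lies strictly between (e.g. `Q = 15`, `m = 1`: `0.129 < 0.200 < 0.502`).  This file closes the bracket.

## What is proved (every `Q`; `P` odd, Cond. C.3)

Notation: `ū ∈ ℤ_Q^U` is the residue pattern `u_i mod Q`, `i ∈ U`, of a Fourier outcome `u`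
(`resid`); for `β ∈ ℤ_Q^U`, `span β = {Σ_i c_i β_i} ≤ ℤ_Q` (the ideal generated by the `β_i`, of size
`Q / gcd(β, Q)`).  The value is
`V(Q, m) = Q^{-m} · Σ_{β ∈ ℤ_Q^U} 1/#span(β)`  (`datumValue`; `= E_u[1/#span(ū)] = (1/Q)·E_u[gcd(ū, Q)]`).
* **Upper bound** (`datum_success_prob_le_value`): for EVERY POVM on the Step-9 register with outcomes in
  `ℤ_Q`, the class success probability is `≤ V(Q, m)`.  Mechanism (`POVM.sum_weight_le_of_keyed`, an
  abstract lemma): the state given the datum is block diagonal in the residue pattern `ū` (T10), and on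
  the block `ū = β` it depends on `a` only through `a mod span(β)`-classes — data `a, a′` with
  `a′ − a ∈ span β` give the SAME block (`datumGram_eq_of_sub_mem_span`: the datum enters through
  `ψ_Q(a·σ)` with `σ` annihilated by every `β_i`).  Positivity and completeness of the POVM then give at
  most `1/#span(β)` of the block's weight to correct guesses.
* **Attainment** (`datumReadoutGen`, `datumReadoutGen_weight`): an explicit POVM built from PUBLIC data
  `(U, bk, v′)` only — "read `ū`; on the block `ū = β` measure in the orthogonal system of BLOCK-TWISTED
  kets `w_{β,r}(u) = [ū = β]·ψ_Q(−r·λ(u))·QFT|φ8.bk,v′⟩(u)`, `r ∈ ℤ_Q`, and on seeing `r` output a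
  uniformly random element of the class `r + span(β)`" — gives EVERY member `(a,(s,c))` of the class the
  Born weight of a correct guess EXACTLY `V(Q,m)·P·N^{n+1}` (the member's norm is `P·N^{n+1}`).  The
  mechanism (`datumKet_eq_blockKet`): on the block `ū = β` every member ket IS, up to a global phase, the
  twisted ket `w_{β, a − 2τ}` with `τ = Σ_{i∈U}((b_i − bk_i)/p₁ + 2s_i)β_i ∈ span(β)` — the secret moves
  the twist only INSIDE the class `a + span(β)` (T12 is the block `β = 0`, where the class is `{a}`).
* Hence (`datum_success_prob_isGreatest`, `datum_minimax`): `V(Q, m)` is the EXACT optimum over all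
  POVMs, Bayes and minimax, for every `Q`; `Shape.datum_privacy_optimum` renders it for every admissible
  shape.  For prime `Q`, `datumValue_of_prime`: `V = 1/Q + (1 − 1/Q)/Q^m` (T12's value, now a corollary).
* **Closed form** (§6, character sums counted two ways): `#span(β)·#ann(β) = Q` with
  `ann(β) = {σ ∈ ℤ_Q : σβ_i = 0 ∀ i}` (`card_span_mul_card_ann`), hence
  `V(Q, m) = Q^{-(m+1)}·Σ_β #ann(β) = Q^{-(m+1)}·Σ_{σ ∈ ℤ_Q} #{x ∈ ℤ_Q : σx = 0}^m`
  (`datumValue_eq_sum_card_ann`, `datumValue_eq_sum_pow`) — one sum over `ℤ_Q` of `gcd(σ, Q)^m`, i.e.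
  `Q^{-(m+1)}·Σ_{d ∣ Q} φ(Q/d)·d^m`; e.g. `Q = 15`, `m = 1`: `(15 + 2·5 + 4·3 + 8)/225 = 1/5`.

Reading (census T13 / rows G1, G2, §6 item (4)): the single-run information content of the Step-9
register about the missing datum is now known EXACTLY for the moduli that actually occur in Chen's
algorithm (composite `Q`).  `V(Q,m) ≤ d(Q)/Q`-type quantities stay `O(τ(Q)/Q)`; nothing here rescues
Step 9 (T5: a wrong datum yields a uniformly shifted, useless relation), and nothing between `V(Q,m)` and
`1` is left to look for in this class of repairs.

## What is NOT here

The identification `#{x ∈ ℤ_Q : σx = 0} = gcd(σ, Q)` and the divisor-sum rendering (elementary, left to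
the reader and to the bundle numerics, which tabulate `V`); the identification of the class shifts with
all secret-ignorant side information (census §0, by hand, as in T10/T12); several runs (T11 bounds them;
the multi-run optimum is not computed); any algorithm.

References: [ChenQuantumLattice2024] as above; [NielsenChuang2010] §2.2.6 (POVMs), Box 2.3 / §9.2
(state discrimination); [Korobov1992] Ch. I §§1, 3 (orthogonality of characters, Gauss sums, via T3/T12).
-/

namespace Literature.Computability.Cryptography.Chen2024

open scoped BigOperators ComplexOrder
open Matrix

/-! ### 1. Two abstract lemmas on POVMs: keyed blocks with symmetry classes; routed orthogonal systems -/

section Keyed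

variable {X I A K : Type*} [Fintype X] [DecidableEq X] [Fintype I] [Fintype A] [Fintype K] [DecidableEq K]

/-- **Class lemma (state discrimination, keyed blocks with symmetry classes).**  Let `ρ_a` (`a ∈ A`) be
the Gram matrices of ket families `q a`, block diagonal for a key `key : X → K` (entries across blocks
vanish), and suppose that on the block `k` the matrix `ρ_{a′}` equals `ρ_a` whenever `rel k a a′`, every
class `{a′ : rel k a a′}` having `N k > 0` elements.  Then for every POVM `E` with outcomes in `A`:
`Σ_a tr(E_a ρ_a) ≤ Σ_k (1/N_k)·Σ_a tr_k(ρ_a)` — on the block `k`, `tr(E_a ρ_a) = (1/N_k)Σ_{a′ ~ a} tr(E_a ρ_{a′})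
≤ (1/N_k)Σ_{a′} tr(E_a ρ_{a′})` by positivity, and `Σ_a E_a = 1` turns the last sum into the block trace.
[cite: NielsenChuang2010, §2.2.6 p. 90, Box 2.3 p. 87] -/
theorem POVM.sum_weight_le_of_keyed (E : POVM X A) (q : A → I → X → ℂ) (key : X → K)
    (rel : K → A → A → Prop) [∀ k a a', Decidable (rel k a a')] (N : K → ℕ) (hNpos : ∀ k, 0 < N k)
    (hN : ∀ k a, (Finset.univ.filter (rel k a)).card = N k)
    (hrel : ∀ k a a' x x', rel k a a' → key x = k → key x' = k →
      ketGram (q a') x x' = ketGram (q a) x x')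
    (hoff : ∀ a x x', key x ≠ key x' → ketGram (q a) x x' = 0) :
    ∑ a, ∑ i, E.weight (q a i) a
      ≤ ∑ k, (((N k : ℝ)⁻¹ : ℝ) : ℂ)
          * ∑ a, ∑ x ∈ Finset.univ.filter (fun x => key x = k), ketGram (q a) x x := by
  -- the kets restricted to the block `k`
  set qK : K → A → I → X → ℂ := fun k a i x => if key x = k then q a i x else 0 with hqK
  have hgramK : ∀ k a x x', ketGram (qK k a) x x'
      = if key x = k ∧ key x' = k then ketGram (q a) x x' else 0 := by
    intro k a x x'
    unfold ketGram
    split_ifs with h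
    · simp only [hqK, if_pos h.1, if_pos h.2]
    · rw [not_and_or] at h
      refine Finset.sum_eq_zero fun i _ => ?_
      rcases h with h | h
      · simp only [hqK, if_neg h, zero_mul]
      · simp only [hqK, if_neg h, map_zero, mul_zero]
  -- block decomposition of the Gram matrices
  have hsplit : ∀ a x x', ketGram (q a) x' x = ∑ k, ketGram (qK k a) x' x := by
    intro a x x'
    simp_rw [hgramK]
    by_cases hxx : key x' = key x
    · rw [Finset.sum_eq_single (key x) (fun k _ hk => if_neg fun h => hk h.2.symm)
          (fun h => absurd (Finset.mem_univ _) h), if_pos ⟨hxx, rfl⟩]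
    · rw [hoff a x' x hxx]
      exact (Finset.sum_eq_zero fun k _ => if_neg fun h => hxx (h.1.trans h.2.symm)).symm
  -- hence the weights decompose over the blocks
  have hW : ∀ a, ∑ i, E.weight (q a i) a = ∑ k, ∑ i, E.weight (qK k a i) a := by
    intro a
    have h1 : ∑ i, E.weight (q a i) a
        = ∑ x, ∑ x', ∑ k, E.effect a x x' * ketGram (qK k a) x' x := by
      rw [E.sum_weight_eq_gram]
      refine Finset.sum_congr rfl fun x _ => Finset.sum_congr rfl fun x' _ => ?_
      rw [hsplit a x x', Finset.mul_sum]
    rw [h1]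
    calc ∑ x, ∑ x', ∑ k, E.effect a x x' * ketGram (qK k a) x' x
        = ∑ x, ∑ k, ∑ x', E.effect a x x' * ketGram (qK k a) x' x :=
          Finset.sum_congr rfl fun x _ => Finset.sum_comm
      _ = ∑ k, ∑ x, ∑ x', E.effect a x x' * ketGram (qK k a) x' x := Finset.sum_comm
      _ = ∑ k, ∑ i, E.weight (qK k a i) a :=
          Finset.sum_congr rfl fun k _ => (E.sum_weight_eq_gram (qK k a) a).symm
  -- related data have the same restricted Gram matrix, hence the same weights
  have hrelW : ∀ k a a', rel k a a' →
      ∑ i, E.weight (qK k a' i) a = ∑ i, E.weight (qK k a i) a := by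
    intro k a a' h
    rw [E.sum_weight_eq_gram, E.sum_weight_eq_gram]
    refine Finset.sum_congr rfl fun x _ => Finset.sum_congr rfl fun x' _ => ?_
    rw [hgramK, hgramK]
    split_ifs with hx
    · rw [hrel k a a' x' x h hx.1 hx.2]
    · rfl
  -- per block and datum: average over the class, then bound by the sum over all data
  have hblock : ∀ k a, ∑ i, E.weight (qK k a i) a
      ≤ (((N k : ℝ)⁻¹ : ℝ) : ℂ) * ∑ a', ∑ i, E.weight (qK k a' i) a := by
    intro k a
    have hNk : ((N k : ℕ) : ℂ) ≠ 0 := by exact_mod_cast (hNpos k).ne'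
    have hcong : ∑ a' ∈ Finset.univ.filter (rel k a), ∑ i, E.weight (qK k a' i) a
        = ∑ a' ∈ Finset.univ.filter (rel k a), ∑ i, E.weight (qK k a i) a :=
      Finset.sum_congr rfl fun a' ha' => hrelW k a a' (Finset.mem_filter.1 ha').2
    have havg : ∑ i, E.weight (qK k a i) a
        = (((N k : ℝ)⁻¹ : ℝ) : ℂ)
          * ∑ a' ∈ Finset.univ.filter (rel k a), ∑ i, E.weight (qK k a' i) a := by
      rw [hcong, Finset.sum_const, hN k a, nsmul_eq_mul, ← mul_assoc, Complex.ofReal_inv,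
        Complex.ofReal_natCast, inv_mul_cancel₀ hNk, one_mul]
    rw [havg]
    refine mul_le_mul_of_nonneg_left ?_ ?_
    · exact Finset.sum_le_sum_of_subset_of_nonneg (Finset.subset_univ _) fun a' _ _ =>
        Finset.sum_nonneg fun i _ => E.weight_nonneg _ _
    · exact Complex.zero_le_real.2 (inv_nonneg.2 (Nat.cast_nonneg _))
  -- the restricted kets' norms are the block traces
  have hnormK : ∀ k a', ∑ i, star (qK k a' i) ⬝ᵥ qK k a' i
      = ∑ x ∈ Finset.univ.filter (fun x => key x = k), ketGram (q a') x x := by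
    intro k a'
    simp only [dotProduct, Pi.star_apply, Complex.star_def]
    rw [Finset.sum_comm, Finset.sum_filter]
    refine Finset.sum_congr rfl fun x _ => ?_
    by_cases hx : key x = k
    · rw [if_pos hx, ketGram]
      refine Finset.sum_congr rfl fun i _ => ?_
      simp only [hqK, if_pos hx]
      rw [mul_comm]
    · rw [if_neg hx]
      refine Finset.sum_eq_zero fun i _ => ?_
      simp only [hqK, if_neg hx, mul_zero]
  -- column sums: `Σ_a ⟨q_k a′|E_a|q_k a′⟩ = ‖q_k a′‖² = tr_k ρ_{a′}`
  have hcol : ∀ k a', ∑ a, ∑ i, E.weight (qK k a' i) a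
      = ∑ x ∈ Finset.univ.filter (fun x => key x = k), ketGram (q a') x x := by
    intro k a'
    rw [Finset.sum_comm, ← hnormK k a']
    exact Finset.sum_congr rfl fun i _ => E.sum_weight _
  calc ∑ a, ∑ i, E.weight (q a i) a
      = ∑ a, ∑ k, ∑ i, E.weight (qK k a i) a := Finset.sum_congr rfl fun a _ => hW a
    _ = ∑ k, ∑ a, ∑ i, E.weight (qK k a i) a := Finset.sum_comm
    _ ≤ ∑ k, ∑ a, (((N k : ℝ)⁻¹ : ℝ) : ℂ) * ∑ a', ∑ i, E.weight (qK k a' i) a :=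
        Finset.sum_le_sum fun k _ => Finset.sum_le_sum fun a _ => hblock k a
    _ = ∑ k, (((N k : ℝ)⁻¹ : ℝ) : ℂ)
          * ∑ a', ∑ x ∈ Finset.univ.filter (fun x => key x = k), ketGram (q a') x x := by
        refine Finset.sum_congr rfl fun k _ => ?_
        rw [← Finset.mul_sum]
        congr 1
        calc ∑ a, ∑ a', ∑ i, E.weight (qK k a' i) a
            = ∑ a', ∑ a, ∑ i, E.weight (qK k a' i) a := Finset.sum_comm
          _ = _ := Finset.sum_congr rfl fun a' _ => hcol k a'

end Keyed

section Routing

variable {X J A : Type*} [Fintype X] [DecidableEq X] [Fintype J] [DecidableEq J] [Fintype A]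
  [Nonempty A] {w : J → X → ℂ} {c : ℝ}

/-- **The routed POVM of an orthogonal system.**  For pairwise orthogonal kets `w_j` of common squared
norm `c > 0` and a stochastic ROUTING `κ(a | j) ≥ 0`, `Σ_a κ(a | j) = 1`:
`E_a = Σ_j κ(a|j)·c⁻¹|w_j⟩⟨w_j| + |A|⁻¹(1 − Π)` — measure in the system, then draw the output `a` from
`κ(· | j)`; guess blindly off the span. [cite: NielsenChuang2010, §2.2.6 p. 90, Box 2.3 p. 87] -/
noncomputable def POVM.ofRouting (w : J → X → ℂ) (c : ℝ) (hc : 0 < c)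
    (horth : ∀ j j', star (w j) ⬝ᵥ w j' = if j = j' then (c : ℂ) else 0)
    (κ : A → J → ℝ) (hκ : ∀ a j, 0 ≤ κ a j) (hκ1 : ∀ j, ∑ a, κ a j = 1) : POVM X A where
  effect a := ∑ j, ((κ a j * c⁻¹ : ℝ) : ℂ) • vecMulVec (w j) (star (w j))
    + (((Fintype.card A : ℝ)⁻¹ : ℝ) : ℂ) • (1 - spanProj w c)
  posSemidef a := by
    refine Matrix.PosSemidef.add ?_ ?_
    · exact posSemidef_sum Finset.univ fun j _ =>
        (posSemidef_vecMulVec_self_star (w j)).smul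
          (Complex.zero_le_real.2 (mul_nonneg (hκ a j) (inv_nonneg.2 hc.le)))
    · exact (posSemidef_one_sub_spanProj hc horth).smul
        (Complex.zero_le_real.2 (inv_nonneg.2 (Nat.cast_nonneg _)))
  sum_eq_one := by
    have hA : (Fintype.card A : ℂ) ≠ 0 := by exact_mod_cast Fintype.card_ne_zero
    have hk : (Fintype.card A : ℂ) * (((Fintype.card A : ℝ)⁻¹ : ℝ) : ℂ) = 1 := by
      rw [Complex.ofReal_inv, Complex.ofReal_natCast, mul_inv_cancel₀ hA]
    have hj : ∀ j, ∑ a, ((κ a j * c⁻¹ : ℝ) : ℂ) • vecMulVec (w j) (star (w j))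
        = ((c⁻¹ : ℝ) : ℂ) • vecMulVec (w j) (star (w j)) := by
      intro j
      rw [← Finset.sum_smul, ← Complex.ofReal_sum, ← Finset.sum_mul, hκ1 j, one_mul]
    rw [Finset.sum_add_distrib, Finset.sum_const, Finset.card_univ, ← Nat.cast_smul_eq_nsmul ℂ,
      smul_smul, hk, one_smul, Finset.sum_comm, Finset.sum_congr rfl fun j _ => hj j]
    change spanProj w c + (1 - spanProj w c) = 1
    rw [add_sub_cancel]

/-- **Weights of the routed POVM.**  With the overlaps `z_j = ⟨w_j|ψ⟩`:
`⟨ψ|E_a|ψ⟩ = Σ_j κ(a|j)·c⁻¹·|z_j|² + |A|⁻¹·(‖ψ‖² − c⁻¹Σ_j |z_j|²)`.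
[cite: NielsenChuang2010, §2.2.6 p. 90] -/
theorem POVM.ofRouting_weight (hc : 0 < c)
    (horth : ∀ j j', star (w j) ⬝ᵥ w j' = if j = j' then (c : ℂ) else 0)
    (κ : A → J → ℝ) (hκ : ∀ a j, 0 ≤ κ a j) (hκ1 : ∀ j, ∑ a, κ a j = 1) (ψ : X → ℂ) (a : A) :
    (POVM.ofRouting w c hc horth κ hκ hκ1).weight ψ a
      = ∑ j, ((κ a j * c⁻¹ : ℝ) : ℂ) * ((starRingEnd ℂ) (star (w j) ⬝ᵥ ψ) * (star (w j) ⬝ᵥ ψ))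
        + (((Fintype.card A : ℝ)⁻¹ : ℝ) : ℂ) * (star ψ ⬝ᵥ ψ
            - ∑ j, ((c⁻¹ : ℝ) : ℂ) * ((starRingEnd ℂ) (star (w j) ⬝ᵥ ψ) * (star (w j) ⬝ᵥ ψ))) := by
  have hzz : ∀ j, star ψ ⬝ᵥ w j = (starRingEnd ℂ) (star (w j) ⬝ᵥ ψ) := by
    intro j
    rw [star_dotProduct, Complex.star_def]
  have h1 : ∀ j, star ψ ⬝ᵥ ((((κ a j * c⁻¹ : ℝ) : ℂ) • vecMulVec (w j) (star (w j))) *ᵥ ψ)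
      = ((κ a j * c⁻¹ : ℝ) : ℂ) * ((starRingEnd ℂ) (star (w j) ⬝ᵥ ψ) * (star (w j) ⬝ᵥ ψ)) := by
    intro j
    rw [smul_mulVec, vecMulVec_star_mulVec, dotProduct_smul, dotProduct_smul, hzz j, smul_eq_mul,
      smul_eq_mul]
    ring
  have h2 : ∀ j, star ψ ⬝ᵥ ((((c⁻¹ : ℝ) : ℂ) * (star (w j) ⬝ᵥ ψ)) • w j)
      = ((c⁻¹ : ℝ) : ℂ) * ((starRingEnd ℂ) (star (w j) ⬝ᵥ ψ) * (star (w j) ⬝ᵥ ψ)) := by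
    intro j
    rw [dotProduct_smul, hzz j, smul_eq_mul]
    ring
  unfold POVM.weight POVM.ofRouting
  dsimp only
  rw [add_mulVec, dotProduct_add, Matrix.sum_mulVec, dotProduct_sum, smul_mulVec, sub_mulVec,
    one_mulVec, dotProduct_smul, dotProduct_sub, spanProj_mulVec, dotProduct_sum, smul_eq_mul]
  simp_rw [h1, h2]

/-- **Aligned kets.**  If `ψ` overlaps only a SELECTED sub-family, with `⟨w_j|ψ⟩ = [j selected]·θ_j·c`,
`|θ_j| = 1`, and lies in the span (`‖ψ‖² = c·#selected`), then outcome `a` gets exactly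
`c·Σ_{j selected} κ(a|j)`. [cite: NielsenChuang2010, §2.2.6 p. 90] -/
theorem POVM.ofRouting_weight_of_aligned (hc : 0 < c)
    (horth : ∀ j j', star (w j) ⬝ᵥ w j' = if j = j' then (c : ℂ) else 0)
    (κ : A → J → ℝ) (hκ : ∀ a j, 0 ≤ κ a j) (hκ1 : ∀ j, ∑ a, κ a j = 1) {ψ : X → ℂ} {a : A}
    (sel : J → Prop) [DecidablePred sel] (θ : J → ℂ) (hθ : ∀ j, (starRingEnd ℂ) (θ j) * θ j = 1)
    (hal : ∀ j, star (w j) ⬝ᵥ ψ = if sel j then θ j * (c : ℂ) else 0)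
    (hnorm : star ψ ⬝ᵥ ψ = (c : ℂ) * ((Finset.univ.filter sel).card : ℂ)) :
    (POVM.ofRouting w c hc horth κ hκ hκ1).weight ψ a
      = (c : ℂ) * ∑ j ∈ Finset.univ.filter sel, ((κ a j : ℝ) : ℂ) := by
  have hc0 : (c : ℂ) ≠ 0 := by exact_mod_cast hc.ne'
  have hsq : ∀ j, (starRingEnd ℂ) (star (w j) ⬝ᵥ ψ) * (star (w j) ⬝ᵥ ψ)
      = if sel j then (c : ℂ) * (c : ℂ) else 0 := by
    intro j
    rw [hal j]
    split_ifs with hj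
    · rw [map_mul, Complex.conj_ofReal, mul_mul_mul_comm, hθ j, one_mul]
    · rw [mul_zero]
  rw [POVM.ofRouting_weight hc horth κ hκ hκ1 ψ a]
  simp_rw [hsq, mul_ite, mul_zero]
  rw [← Finset.sum_filter, ← Finset.sum_filter, hnorm]
  have h2 : ∑ j ∈ Finset.univ.filter sel, ((c⁻¹ : ℝ) : ℂ) * ((c : ℂ) * (c : ℂ))
      = (c : ℂ) * ((Finset.univ.filter sel).card : ℂ) := by
    rw [Finset.sum_const, nsmul_eq_mul, Complex.ofReal_inv, inv_mul_cancel_left₀ hc0, mul_comm]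
  rw [h2, sub_self, mul_zero, add_zero, Finset.mul_sum]
  refine Finset.sum_congr rfl fun j _ => ?_
  rw [Complex.ofReal_mul, Complex.ofReal_inv, mul_assoc, inv_mul_cancel_left₀ hc0, mul_comm]

end Routing

/-! ### 2. Spans in `ℤ_Q`, residue patterns, block counts and block character sums -/

section Span

variable (Q : ℕ+) {ι : Type*} [Fintype ι]

/-- The linear-combination map `c ↦ Σ_i c_i β_i : ℤ_Q^ι → ℤ_Q`. [folklore] -/
def linComb (β : ι → ZQ Q) : (ι → ZQ Q) →+ ZQ Q where
  toFun c := ∑ i, c i * β i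
  map_zero' := by simp only [Pi.zero_apply, zero_mul, Finset.sum_const_zero]
  map_add' c c' := by
    rw [← Finset.sum_add_distrib]
    exact Finset.sum_congr rfl fun i _ => by rw [Pi.add_apply, add_mul]

/-- `span β = {Σ_i c_i β_i} ≤ ℤ_Q`, the ideal generated by the residues `β_i` (of size `Q/gcd(β, Q)`).
[folklore] -/
def span (β : ι → ZQ Q) : AddSubgroup (ZQ Q) := (linComb Q β).range

/-- Membership in the span. [folklore] -/
theorem mem_span_iff (β : ι → ZQ Q) (r : ZQ Q) : r ∈ span Q β ↔ ∃ c : ι → ZQ Q, ∑ i, c i * β i = r :=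
  AddMonoidHom.mem_range

/-- `#span β > 0`. [folklore] -/
theorem card_span_pos (β : ι → ZQ Q) : 0 < Nat.card (span Q β) :=
  Nat.card_pos_iff.2 ⟨⟨⟨0, zero_mem _⟩⟩, inferInstance⟩

/-- The class `{a′ : a′ − a ∈ span β}` of a datum has `#span β` elements. [folklore] -/
theorem card_class_eq (β : ι → ZQ Q) (a : ZQ Q) [DecidablePred fun a' : ZQ Q => a' - a ∈ span Q β] :
    (Finset.univ.filter fun a' : ZQ Q => a' - a ∈ span Q β).card = Nat.card (span Q β) := by
  rw [← Fintype.card_subtype, ← Nat.card_eq_fintype_card]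
  exact Nat.card_congr (Equiv.subtypeEquiv (Equiv.subRight a) fun a' => Iff.rfl)

/-- The class `{a : r − a ∈ span β}` has `#span β` elements. [folklore] -/
theorem card_class_eq' (β : ι → ZQ Q) (r : ZQ Q) [DecidablePred fun a : ZQ Q => r - a ∈ span Q β] :
    (Finset.univ.filter fun a : ZQ Q => r - a ∈ span Q β).card = Nat.card (span Q β) := by
  rw [← Fintype.card_subtype, ← Nat.card_eq_fintype_card]
  exact Nat.card_congr (Equiv.subtypeEquiv (Equiv.subLeft r) fun a => Iff.rfl)

/-- For prime `Q`: `span 0 = 0` and `span β = ℤ_Q` otherwise, so `#span β = [β = 0] + [β ≠ 0]·Q`.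
[folklore] -/
theorem card_span_of_prime [Fact (Nat.Prime ((Q : ℕ+) : ℕ))] [DecidableEq ι] (β : ι → ZQ Q) :
    Nat.card (span Q β) = if β = 0 then 1 else ((Q : ℕ+) : ℕ) := by
  split_ifs with hβ
  · have h : span Q β = ⊥ := by
      refine (AddSubgroup.eq_bot_iff_forall _).2 fun r hr => ?_
      obtain ⟨c, rfl⟩ := (mem_span_iff Q β r).1 hr
      simp only [hβ, Pi.zero_apply, mul_zero, Finset.sum_const_zero]
    rw [h, AddSubgroup.card_bot]
  · obtain ⟨i, hi⟩ : ∃ i, β i ≠ 0 := by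
      by_contra h
      push Not at h
      exact hβ (funext h)
    have h : span Q β = ⊤ := by
      refine (AddSubgroup.eq_top_iff' _).2 fun r => (mem_span_iff Q β r).2 ⟨Pi.single i (r * (β i)⁻¹), ?_⟩
      rw [Finset.sum_eq_single i (fun j _ hj => by rw [Pi.single_eq_of_ne hj, zero_mul])
        (fun h => absurd (Finset.mem_univ i) h), Pi.single_eq_same, mul_assoc, inv_mul_cancel₀ hi, mul_one]
    rw [h, AddSubgroup.card_top, Nat.card_eq_fintype_card, ZMod.card]

variable (ι) in
/-- **The value** `V(Q, ι) = Q^{-#ι}·Σ_{β ∈ ℤ_Q^ι} 1/#span(β)` (`= E_β[1/#span β] = (1/Q)·E_β[gcd(β, Q)]`):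
the exact optimum of T13, with `ι = U`. [cite: ChenQuantumLattice2024, §3.5.9 pp. 35–37] -/
noncomputable def datumValue [DecidableEq ι] : ℝ :=
  (∑ β : ι → ZQ Q, ((Nat.card (span Q β) : ℝ))⁻¹) / (((Q : ℕ+) : ℕ) : ℝ) ^ Fintype.card ι

variable (ι) in
/-- **Prime `Q`**: `V(Q, ι) = 1/Q + (1 − 1/Q)/Q^{#ι}` — the value of T12. [folklore] -/
theorem datumValue_of_prime [Fact (Nat.Prime ((Q : ℕ+) : ℕ))] [DecidableEq ι] :
    datumValue Q ι = 1 / ((Q : ℕ+) : ℕ) + (1 - 1 / ((Q : ℕ+) : ℕ)) / (((Q : ℕ+) : ℕ) : ℝ) ^ Fintype.card ι := by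
  unfold datumValue
  have hQ : (0 : ℝ) < ((Q : ℕ+) : ℕ) := by exact_mod_cast PNat.pos Q
  have hterm : ∀ β : ι → ZQ Q, ((Nat.card (span Q β) : ℝ))⁻¹
      = (((Q : ℕ+) : ℕ) : ℝ)⁻¹ + if β = 0 then 1 - (((Q : ℕ+) : ℕ) : ℝ)⁻¹ else 0 := by
    intro β
    rw [card_span_of_prime Q β]
    split_ifs
    · push_cast; ring
    · rw [add_zero]
  have hsum : ∑ β : ι → ZQ Q, ((Nat.card (span Q β) : ℝ))⁻¹
      = ∑ β : ι → ZQ Q, ((((Q : ℕ+) : ℕ) : ℝ)⁻¹ + if β = 0 then 1 - (((Q : ℕ+) : ℕ) : ℝ)⁻¹ else 0) :=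
    Finset.sum_congr rfl fun β _ => hterm β
  rw [hsum, Finset.sum_add_distrib, Finset.sum_const, Finset.card_univ,
    Finset.sum_ite_eq' Finset.univ (0 : ι → ZQ Q), if_pos (Finset.mem_univ _), Fintype.card_fun, ZMod.card,
    nsmul_eq_mul, Nat.cast_pow]
  have hy : (((Q : ℕ+) : ℕ) : ℝ) ^ Fintype.card ι * ((((Q : ℕ+) : ℕ) : ℝ) ^ Fintype.card ι)⁻¹ = 1 :=
    mul_inv_cancel₀ (pow_ne_zero _ hQ.ne')
  simp only [div_eq_mul_inv, one_mul]
  linear_combination (((Q : ℕ+) : ℕ) : ℝ)⁻¹ * hy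

end Span

section Blocks

variable (n : ℕ) (D p₁ Q : ℕ+)

/-- The RESIDUE PATTERN of a Fourier outcome on the unknown coordinates: `ū = (u_i mod Q)_{i ∈ U} ∈ ℤ_Q^U`
(the key of the block decomposition; `classFreq` restricted to `U`). [folklore] -/
def resid (U : Finset (Fin (n + 1))) (u : Fin (n + 1) → ZN D p₁ Q) : U → ZQ Q :=
  fun i => toQ p₁ Q (toP D (p₁ * Q) (u i))

/-- `classFreq` on `U` is the residue pattern. [folklore] -/
theorem classFreq_eq_resid (U : Finset (Fin (n + 1))) (u : Fin (n + 1) → ZN D p₁ Q) (i : U) :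
    classFreq n D p₁ Q U u i = resid n D p₁ Q U u i := by
  unfold classFreq resid
  rw [if_pos i.2]

/-- Sums against `classFreq` are sums over `U` against the residue pattern. [folklore] -/
theorem sum_mul_classFreq (U : Finset (Fin (n + 1))) (u : Fin (n + 1) → ZN D p₁ Q)
    (f : Fin (n + 1) → ZQ Q) :
    ∑ i, f i * classFreq n D p₁ Q U u i = ∑ i : U, f i * resid n D p₁ Q U u i := by
  have h : ∀ i, f i * classFreq n D p₁ Q U u i
      = if i ∈ U then f i * toQ p₁ Q (toP D (p₁ * Q) (u i)) else 0 := by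
    intro i
    unfold classFreq
    split_ifs
    · rfl
    · rw [mul_zero]
  simp_rw [h]
  rw [Finset.sum_ite_mem, Finset.univ_inter, ← Finset.sum_coe_sort U]
  rfl

/-- Same residue pattern: the class frequencies of the difference vanish on `U`. [folklore] -/
theorem classFreq_sub_eq_zero_of_resid_eq (U : Finset (Fin (n + 1))) {u u' : Fin (n + 1) → ZN D p₁ Q}
    (h : resid n D p₁ Q U u = resid n D p₁ Q U u') : ∀ i ∈ U, classFreq n D p₁ Q U (u' - u) i = 0 := by
  intro i hi
  have hi' := congr_fun h ⟨i, hi⟩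
  unfold resid at hi'
  unfold classFreq
  rw [if_pos hi, Pi.sub_apply, map_sub, map_sub, sub_eq_zero]
  exact hi'.symm

/-- Different residue patterns: some class frequency of the difference is non-zero. [folklore] -/
theorem exists_classFreq_ne_of_resid_ne (U : Finset (Fin (n + 1))) {u u' : Fin (n + 1) → ZN D p₁ Q}
    (h : resid n D p₁ Q U u ≠ resid n D p₁ Q U u') : ∃ i ∈ U, classFreq n D p₁ Q U (u' - u) i ≠ 0 := by
  by_contra hall
  push Not at hall
  refine h (funext fun i => ?_)
  have h0 := hall i i.2
  unfold classFreq at h0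
  rw [if_pos i.2, Pi.sub_apply, map_sub, map_sub, sub_eq_zero] at h0
  exact h0.symm

/-- Shifting a free coordinate `i₀ ∉ U` does not move the residue pattern. [folklore] -/
theorem resid_add_single (U : Finset (Fin (n + 1))) {i₀ : Fin (n + 1)} (hi₀ : i₀ ∉ U)
    (u : Fin (n + 1) → ZN D p₁ Q) (z : ZN D p₁ Q) :
    resid n D p₁ Q U (u + Pi.single i₀ z) = resid n D p₁ Q U u := by
  funext i
  have hne : (i : Fin (n + 1)) ≠ i₀ := fun h => hi₀ (h ▸ i.2)
  unfold resid
  rw [Pi.add_apply, Pi.single_eq_of_ne hne, add_zero]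

/-- **Size of a residue block**: `#{u : ū = β}·Q^{#U} = N^{n+1}` for EVERY pattern `β` (each constrained
coordinate has `N/Q` residues in its fibre). [folklore] -/
theorem card_resid_mul (U : Finset (Fin (n + 1))) (β : U → ZQ Q) :
    Nat.card {u : Fin (n + 1) → ZN D p₁ Q // resid n D p₁ Q U u = β} * ((Q : ℕ+) : ℕ) ^ U.card
      = ((D * D * (p₁ * Q) : ℕ+) : ℕ) ^ (n + 1) := by
  classical
  have h1 : Nat.card {u : Fin (n + 1) → ZN D p₁ Q // resid n D p₁ Q U u = β}
      = Nat.card {u : Fin (n + 1) → ZN D p₁ Q //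
          ∀ i, ∀ h : i ∈ U, toQ p₁ Q (toP D (p₁ * Q) (u i)) = β ⟨i, h⟩} := by
    refine Nat.card_congr (Equiv.subtypeEquivRight fun u => ?_)
    rw [funext_iff, Subtype.forall]
    rfl
  have h2 : Nat.card {u : Fin (n + 1) → ZN D p₁ Q //
        ∀ i, ∀ h : i ∈ U, toQ p₁ Q (toP D (p₁ * Q) (u i)) = β ⟨i, h⟩}
      = ∏ i : Fin (n + 1),
          Nat.card {x : ZN D p₁ Q // ∀ h : i ∈ U, toQ p₁ Q (toP D (p₁ * Q) x) = β ⟨i, h⟩} := by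
    rw [Nat.card_congr (@Equiv.subtypePiEquivPi (Fin (n + 1)) (fun _ => ZN D p₁ Q)
      (fun i x => ∀ h : i ∈ U, toQ p₁ Q (toP D (p₁ * Q) x) = β ⟨i, h⟩)), Nat.card_pi]
  have h3 : ∀ i : Fin (n + 1),
      Nat.card {x : ZN D p₁ Q // ∀ h : i ∈ U, toQ p₁ Q (toP D (p₁ * Q) x) = β ⟨i, h⟩}
        * (if i ∈ U then ((Q : ℕ+) : ℕ) else 1) = ((D * D * (p₁ * Q) : ℕ+) : ℕ) := by
    intro i
    by_cases hi : i ∈ U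
    · rw [if_pos hi, Nat.card_congr (Equiv.subtypeEquivRight (fun x => ⟨fun h => h hi, fun h _ => h⟩) :
        {x : ZN D p₁ Q // ∀ h : i ∈ U, toQ p₁ Q (toP D (p₁ * Q) x) = β ⟨i, h⟩}
          ≃ {x : ZN D p₁ Q // toQ p₁ Q (toP D (p₁ * Q) x) = β ⟨i, hi⟩}),
        Nat.card_eq_fintype_card, Fintype.card_subtype]
      simp_rw [toQ_toP_eq_castHom]
      exact card_filter_castHom_mul (Q_dvd_N D p₁ Q) (β ⟨i, hi⟩)
    · rw [if_neg hi, mul_one, Nat.card_congr (Equiv.subtypeUnivEquiv (fun x h => absurd h hi) :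
        {x : ZN D p₁ Q // ∀ h : i ∈ U, toQ p₁ Q (toP D (p₁ * Q) x) = β ⟨i, h⟩} ≃ ZN D p₁ Q),
        Nat.card_eq_fintype_card, ZMod.card]
  have h4 : ((Q : ℕ+) : ℕ) ^ U.card = ∏ i : Fin (n + 1), (if i ∈ U then ((Q : ℕ+) : ℕ) else 1) := by
    rw [Finset.prod_ite_mem, Finset.univ_inter, Finset.prod_const]
  rw [h1, h2, h4, ← Finset.prod_mul_distrib, Finset.prod_congr rfl fun i _ => h3 i, Finset.prod_const,
    Finset.card_univ, Fintype.card_fin]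

/-- **Character sum over a residue block.**  With `λ(u) = ⟨bk, u mod P⟩ mod Q` and a coordinate `i₀ ∉ U`
where `bk_{i₀}` is a unit mod `Q`: `Σ_{ū = β} ψ_Q(δ·λ(u)) = #{ū = β}·[δ = 0]` (shift `u_{i₀}` by one).
[cite: Korobov1992, Ch. I §1 (orthogonality of characters)] -/
theorem resid_charSum (U : Finset (Fin (n + 1))) (bk : Fin (n + 1) → ℤ)
    (hunit : ∃ i₀, i₀ ∉ U ∧ IsUnit ((bk i₀ : ℤ) : ZQ Q)) (β : U → ZQ Q) (δ : ZQ Q) :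
    ∑ u : Fin (n + 1) → ZN D p₁ Q,
        (if resid n D p₁ Q U u = β
          then (ZMod.stdAddChar (δ * toQ p₁ Q (lineFun n D p₁ Q bk u)) : ℂ) else 0)
      = if δ = 0 then (Nat.card {u : Fin (n + 1) → ZN D p₁ Q // resid n D p₁ Q U u = β} : ℂ) else 0 := by
  classical
  split_ifs with hδ
  · simp only [hδ, zero_mul, AddChar.map_zero_eq_one]
    rw [Finset.sum_boole, ← Fintype.card_subtype, ← Nat.card_eq_fintype_card]
  · obtain ⟨i₀, hi₀, hu⟩ := hunit
    set z : Fin (n + 1) → ZN D p₁ Q := Pi.single i₀ 1 with hz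
    set F : (Fin (n + 1) → ZN D p₁ Q) → ℂ := fun u =>
      if resid n D p₁ Q U u = β then (ZMod.stdAddChar (δ * toQ p₁ Q (lineFun n D p₁ Q bk u)) : ℂ) else 0
      with hF
    have hshift : ∀ u, F (u + z) = ZMod.stdAddChar (δ * ((bk i₀ : ℤ) : ZQ Q)) * F u := by
      intro u
      simp only [hF, hz, resid_add_single n D p₁ Q U hi₀]
      split_ifs with hu'
      · rw [lineFun_add, lineFun_single, map_one, mul_one, map_add, map_intCast, mul_add,
          AddChar.map_add_eq_mul, mul_comm]
      · rw [mul_zero]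
    have hsum : ∑ u, F u = ZMod.stdAddChar (δ * ((bk i₀ : ℤ) : ZQ Q)) * ∑ u, F u := by
      rw [Finset.mul_sum]
      simp_rw [← hshift]
      exact (Fintype.sum_equiv (Equiv.addRight z) (fun u => F (u + z)) F fun u => rfl).symm
    have hne : (ZMod.stdAddChar (δ * ((bk i₀ : ℤ) : ZQ Q)) : ℂ) ≠ 1 := fun h1 =>
      hδ ((hu.mul_left_eq_zero).1 (((ZMod.isPrimitive_stdAddChar _).zmod_char_eq_one_iff _ _).1 h1))
    exact eq_zero_of_mul_eq_self_left hne hsum.symm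

end Blocks

/-! ### 3. The upper bound for every `Q` -/

section Upper

variable (n : ℕ) (D p₁ Q : ℕ+)

/-- **Data in one class give the same block.**  On the residue block `ū = ū′`, if `a′ − a ∈ span(ū)` then
`datumGram a′ (u,u′) = datumGram a (u,u′)`: by T10's closed form the datum enters only through `ψ_Q(a·σ)`,
`σ = ⟨b,(u′−u) mod P⟩ mod Q`, on entries where `4σ·ū_i = 0` for all `i ∈ U`, and there
`(a′ − a)·σ = Σ_i c_i ū_i σ = 0` (`4` is a unit for odd `Q`). [cite: ChenQuantumLattice2024, §3.5.9 pp. 35–37] -/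
theorem datumGram_eq_of_sub_mem_span (U : Finset (Fin (n + 1))) (bk b v' : Fin (n + 1) → ℤ)
    (hbk : ∀ i, i ∉ U → bk i = b i) (h4 : IsUnit (4 : ZQ Q)) {u u' : Fin (n + 1) → ZN D p₁ Q}
    (hres : resid n D p₁ Q U u = resid n D p₁ Q U u') {a a' : ZQ Q}
    (haa : a' - a ∈ span Q (resid n D p₁ Q U u)) :
    datumGram n D p₁ Q U bk b v' a' u u' = datumGram n D p₁ Q U bk b v' a u u' := by
  have hcoord := classFreq_sub_eq_zero_of_resid_eq n D p₁ Q U hres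
  rw [datumGram_eq_of_ann n D p₁ Q U bk b v' hbk a' u u' hcoord,
    datumGram_eq_of_ann n D p₁ Q U bk b v' hbk a u u' hcoord]
  by_cases hall : ∀ i ∈ U, 4 * toQ p₁ Q (lineFun n D p₁ Q b (u' - u)) * classFreq n D p₁ Q U u i = 0
  · obtain ⟨c, hc⟩ := (mem_span_iff Q _ _).1 haa
    have hσ : ∀ i : U, toQ p₁ Q (lineFun n D p₁ Q b (u' - u)) * resid n D p₁ Q U u i = 0 := by
      intro i
      have h := hall i i.2
      rw [classFreq_eq_resid, mul_assoc] at h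
      exact h4.mul_right_eq_zero.1 h
    have ha' : a' * toQ p₁ Q (lineFun n D p₁ Q b (u' - u)) = a * toQ p₁ Q (lineFun n D p₁ Q b (u' - u)) := by
      rw [← sub_eq_zero, ← sub_mul, ← hc, Finset.sum_mul]
      exact Finset.sum_eq_zero fun i _ => by rw [mul_right_comm, mul_assoc, hσ i, mul_zero]
    rw [ha']
  · push Not at hall
    obtain ⟨i, -, hi⟩ := hall
    rw [Finset.prod_eq_zero (Finset.mem_univ i) (if_neg hi)]
    simp only [mul_zero, zero_mul]

/-- **T13, upper bound (weight form, every `Q`).**  For EVERY POVM on the Step-9 register with outcomes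
in `ℤ_Q` and odd `P`: `Σ_a Σ_{s,c} ⟨member|E_a|member⟩ ≤ Σ_β (1/#span β)·Q·#{ū = β}·(Q^{n+1}Q^{n+1}P)`.
[cite: ChenQuantumLattice2024, §3.5.9 pp. 35–37; NielsenChuang2010, §2.2.6 p. 90, Box 2.3 p. 87] -/
theorem datum_weight_le_span (hP : Odd ((p₁ * Q : ℕ+) : ℕ)) (U : Finset (Fin (n + 1)))
    (bk b v' : Fin (n + 1) → ℤ) (hbk : ∀ i, i ∉ U → bk i = b i)
    (E : POVM (Fin (n + 1) → ZN D p₁ Q) (ZQ Q)) :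
    ∑ a, ∑ sc, E.weight (datumKet n D p₁ Q U bk b v' a sc) a
      ≤ ∑ β : U → ZQ Q, (((Nat.card (span Q β) : ℝ)⁻¹ : ℝ) : ℂ)
          * ((((Q : ℕ+) : ℕ) : ℂ) * (Nat.card {u : Fin (n + 1) → ZN D p₁ Q // resid n D p₁ Q U u = β} : ℂ)
            * (((((Q : ℕ+) : ℕ) : ℂ)) ^ (n + 1) * ((((Q : ℕ+) : ℕ) : ℂ)) ^ (n + 1)
              * ((((p₁ * Q : ℕ+) : ℕ) : ℂ)))) := by
  classical
  have h := E.sum_weight_le_of_keyed (datumKet n D p₁ Q U bk b v') (resid n D p₁ Q U)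
    (fun β a a' => a' - a ∈ span Q β) (fun β => Nat.card (span Q β)) (fun β => card_span_pos Q β)
    (fun β a => card_class_eq Q β a)
    (fun β a a' x x' hrel hx hx' => by
      rw [ketGram_datumKet, ketGram_datumKet]
      exact datumGram_eq_of_sub_mem_span n D p₁ Q U bk b v' hbk (isUnit_four_of_odd p₁ Q hP)
        (hx.trans hx'.symm) (by rw [hx]; exact hrel))
    (fun a x x' hx => by
      rw [ketGram_datumKet]
      obtain ⟨i, -, hi⟩ := exists_classFreq_ne_of_resid_ne n D p₁ Q U hx
      exact datumGram_eq_zero_of_classFreq_ne n D p₁ Q U bk b v' a x x' hi)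
  refine h.trans (le_of_eq (Finset.sum_congr rfl fun β _ => ?_))
  congr 1
  simp only [ketGram_datumKet, datumGram_self n D p₁ Q hP, Finset.sum_const, Finset.card_univ, ZMod.card,
    nsmul_eq_mul, Nat.card_eq_fintype_card, Fintype.card_subtype]
  push_cast
  ring

/-- **T13, upper bound (probability form, every `Q`).**  Normalising by the total weight of the class
(`datum_totalWeight`): with the datum, the secret shift and the offset shift uniform, EVERY measurement of
the Step-9 register guesses the datum correctly with probability at most `V(Q, m) = Q^{-m}Σ_β 1/#span(β)`,
`m = #U` (`P` odd, Cond. C.3; `#{ū = β} = N^{n+1}/Q^m` for every `β`).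
[cite: ChenQuantumLattice2024, §3.5.9 pp. 35–37; NielsenChuang2010, Box 2.3 p. 87] -/
theorem datum_success_prob_le_value (hP : Odd ((p₁ * Q : ℕ+) : ℕ)) (U : Finset (Fin (n + 1)))
    (bk b v' : Fin (n + 1) → ℤ) (hbk : ∀ i, i ∉ U → bk i = b i)
    (E : POVM (Fin (n + 1) → ZN D p₁ Q) (ZQ Q)) :
    (∑ a, ∑ sc, E.weight (datumKet n D p₁ Q U bk b v' a sc) a).re
        / (∑ a : ZQ Q, ∑ sc,
            star (datumKet n D p₁ Q U bk b v' a sc) ⬝ᵥ datumKet n D p₁ Q U bk b v' a sc).re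
      ≤ datumValue Q U := by
  classical
  have hQ : (0 : ℝ) < ((Q : ℕ+) : ℕ) := by exact_mod_cast PNat.pos Q
  have hP' : (0 : ℝ) < ((p₁ * Q : ℕ+) : ℕ) := by exact_mod_cast PNat.pos _
  have hN : (0 : ℝ) < ((D * D * (p₁ * Q) : ℕ+) : ℕ) := by exact_mod_cast PNat.pos _
  have hB : ∀ β : U → ZQ Q,
      (Nat.card {u : Fin (n + 1) → ZN D p₁ Q // resid n D p₁ Q U u = β} : ℝ) * (((Q : ℕ+) : ℕ) : ℝ) ^ U.card
        = (((D * D * (p₁ * Q) : ℕ+) : ℕ) : ℝ) ^ (n + 1) :=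
    fun β => by exact_mod_cast card_resid_mul n D p₁ Q U β
  have hden : (∑ a : ZQ Q, ∑ sc, star (datumKet n D p₁ Q U bk b v' a sc)
      ⬝ᵥ datumKet n D p₁ Q U bk b v' a sc).re
        = (((Q : ℕ+) : ℕ) : ℝ) * ((((Q : ℕ+) : ℕ) : ℝ) ^ (n + 1) * (((Q : ℕ+) : ℕ) : ℝ) ^ (n + 1)
            * (((p₁ * Q : ℕ+) : ℕ) : ℝ)) * (((D * D * (p₁ * Q) : ℕ+) : ℕ) : ℝ) ^ (n + 1) := by
    rw [datum_totalWeight n D p₁ Q hP, Complex.natCast_re]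
    push_cast
    ring
  have hnum : (∑ a, ∑ sc, E.weight (datumKet n D p₁ Q U bk b v' a sc) a).re
      ≤ ∑ β : U → ZQ Q, ((Nat.card (span Q β) : ℝ))⁻¹
          * ((((Q : ℕ+) : ℕ) : ℝ) * (Nat.card {u : Fin (n + 1) → ZN D p₁ Q // resid n D p₁ Q U u = β} : ℝ)
            * ((((Q : ℕ+) : ℕ) : ℝ) ^ (n + 1) * (((Q : ℕ+) : ℕ) : ℝ) ^ (n + 1)
              * (((p₁ * Q : ℕ+) : ℕ) : ℝ))) := by
    have h := (Complex.le_def.1 (datum_weight_le_span n D p₁ Q hP U bk b v' hbk E)).1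
    refine h.trans (le_of_eq ?_)
    rw [Complex.re_sum]
    refine Finset.sum_congr rfl fun β _ => ?_
    simp only [← Complex.ofReal_natCast, ← Complex.ofReal_mul, ← Complex.ofReal_pow, Complex.ofReal_re]
  rw [hden, div_le_iff₀ (by positivity)]
  refine hnum.trans (le_of_eq ?_)
  unfold datumValue
  rw [Fintype.card_coe, div_mul_eq_mul_div, eq_div_iff (pow_ne_zero _ hQ.ne'), Finset.sum_mul,
    Finset.sum_mul]
  refine Finset.sum_congr rfl fun β _ => ?_
  linear_combination (((Nat.card (span Q β) : ℝ))⁻¹ * (((Q : ℕ+) : ℕ) : ℝ)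
    * ((((Q : ℕ+) : ℕ) : ℝ) ^ (n + 1) * (((Q : ℕ+) : ℕ) : ℝ) ^ (n + 1) * (((p₁ * Q : ℕ+) : ℕ) : ℝ))) * hB β

end Upper

/-! ### 4. The block-twisted read-out attains the value on every member -/

section Readout

variable (n : ℕ) (D p₁ Q : ℕ+)

/-- **The block-twisted kets** (public): `w_{β,r}(u) = [ū = β]·ψ_Q(−r·λ(u))·QFT|φ8.bk,v′⟩(u)`,
`λ(u) = ⟨bk, u mod P⟩ mod Q` (T12's twisted kets are the block `β = 0`).
[cite: ChenQuantumLattice2024, §3.5.9 p. 35, eq. (12) p. 17] -/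
noncomputable def blockKet (U : Finset (Fin (n + 1))) (bk v' : Fin (n + 1) → ℤ) (j : (U → ZQ Q) × ZQ Q)
    (u : Fin (n + 1) → ZN D p₁ Q) : ℂ :=
  if resid n D p₁ Q U u = j.1 then
    (ZMod.stdAddChar (-(j.2 * toQ p₁ Q (lineFun n D p₁ Q bk u))) : ℂ) * qft (phi8bKet n D p₁ Q bk v') u
  else 0

/-- The common squared norm of the block-twisted kets: `c = P·#{ū = 0}` (`= P·#{ū = β} = P·N^{n+1}/Q^{#U}`
for every `β`). [folklore] -/
noncomputable def blockConst (U : Finset (Fin (n + 1))) : ℝ :=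
  (((p₁ * Q : ℕ+) : ℕ) : ℝ) * (Nat.card {u : Fin (n + 1) → ZN D p₁ Q // resid n D p₁ Q U u = 0} : ℝ)

/-- All residue blocks have the size of the block `ū = 0`. [folklore] -/
theorem card_resid_eq (U : Finset (Fin (n + 1))) (β : U → ZQ Q) :
    Nat.card {u : Fin (n + 1) → ZN D p₁ Q // resid n D p₁ Q U u = β}
      = Nat.card {u : Fin (n + 1) → ZN D p₁ Q // resid n D p₁ Q U u = 0} :=
  Nat.eq_of_mul_eq_mul_right (pow_pos (PNat.pos Q) U.card)
    ((card_resid_mul n D p₁ Q U β).trans (card_resid_mul n D p₁ Q U 0).symm)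

/-- `#{ū = 0} > 0`. [folklore] -/
theorem card_resid_zero_pos (U : Finset (Fin (n + 1))) :
    0 < Nat.card {u : Fin (n + 1) → ZN D p₁ Q // resid n D p₁ Q U u = 0} := by
  have h := card_resid_mul n D p₁ Q U 0
  refine Nat.pos_of_ne_zero fun h0 => ?_
  rw [h0, zero_mul] at h
  exact (pow_pos (PNat.pos _) _).ne' h.symm

/-- `c > 0`. [folklore] -/
theorem blockConst_pos (U : Finset (Fin (n + 1))) : 0 < blockConst n D p₁ Q U := by
  unfold blockConst
  have h1 : (0 : ℝ) < (((p₁ * Q : ℕ+) : ℕ) : ℝ) := by exact_mod_cast PNat.pos _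
  have h2 : (0 : ℝ) < (Nat.card {u : Fin (n + 1) → ZN D p₁ Q // resid n D p₁ Q U u = 0} : ℝ) := by
    exact_mod_cast card_resid_zero_pos n D p₁ Q U
  exact mul_pos h1 h2

/-- The entrywise products behind the overlaps, same block index: on `ū = β`,
`conj w_{β,r}(u)·w_{β,r′}(u) = P·ψ_Q((r − r′)·λ(u))` (flat spectrum, T3); zero off the block.
[cite: ChenQuantumLattice2024, §3.5.9 p. 35; Korobov1992, Ch. I §3 Thm 3] -/
theorem star_blockKet_mul_blockKet_same (hP : Odd ((p₁ * Q : ℕ+) : ℕ)) (U : Finset (Fin (n + 1)))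
    (bk v' : Fin (n + 1) → ℤ) (β : U → ZQ Q) (r r' : ZQ Q) (u : Fin (n + 1) → ZN D p₁ Q) :
    star (blockKet n D p₁ Q U bk v' (β, r) u) * blockKet n D p₁ Q U bk v' (β, r') u
      = (((p₁ * Q : ℕ+) : ℕ) : ℂ) * (if resid n D p₁ Q U u = β
          then (ZMod.stdAddChar ((r - r') * toQ p₁ Q (lineFun n D p₁ Q bk u)) : ℂ) else 0) := by
  unfold blockKet
  dsimp only
  by_cases hu : resid n D p₁ Q U u = β
  · rw [if_pos hu, if_pos hu, if_pos hu, Complex.star_def, map_mul, ← AddChar.map_neg_eq_conj, neg_neg,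
      mul_mul_mul_comm, ← AddChar.map_add_eq_mul, mul_comm ((starRingEnd ℂ) _), ← fourierGram,
      fourierGram_self n D p₁ Q hP, mul_comm]
    congr 2
    ring
  · rw [if_neg hu, if_neg hu, if_neg hu, star_zero, zero_mul, mul_zero]

/-- Different block indices: the entrywise products vanish (disjoint supports). [folklore] -/
theorem star_blockKet_mul_blockKet_ne (U : Finset (Fin (n + 1))) (bk v' : Fin (n + 1) → ℤ)
    {β β' : U → ZQ Q} (hββ : β ≠ β') (r r' : ZQ Q) (u : Fin (n + 1) → ZN D p₁ Q) :
    star (blockKet n D p₁ Q U bk v' (β, r) u) * blockKet n D p₁ Q U bk v' (β', r') u = 0 := by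
  unfold blockKet
  dsimp only
  by_cases hu : resid n D p₁ Q U u = β
  · rw [if_neg (show ¬ resid n D p₁ Q U u = β' from fun h => hββ (hu.symm.trans h)), mul_zero]
  · rw [if_neg hu, star_zero, zero_mul]

/-- **Orthogonality of the block-twisted kets**: `⟨w_j|w_{j′}⟩ = [j = j′]·c`, provided some coordinate
`i₀ ∉ U` has `bk_{i₀}` a unit mod `Q` (Chen: `bk₀ = b₀ = −1`, `0 ∉ U`).
[cite: ChenQuantumLattice2024, §3.5.9 p. 35, eq. (12) p. 17] -/
theorem blockKet_orth (hP : Odd ((p₁ * Q : ℕ+) : ℕ)) (U : Finset (Fin (n + 1)))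
    (bk v' : Fin (n + 1) → ℤ) (hunit : ∃ i₀, i₀ ∉ U ∧ IsUnit ((bk i₀ : ℤ) : ZQ Q))
    (j j' : (U → ZQ Q) × ZQ Q) :
    star (blockKet n D p₁ Q U bk v' j) ⬝ᵥ blockKet n D p₁ Q U bk v' j'
      = if j = j' then ((blockConst n D p₁ Q U : ℝ) : ℂ) else 0 := by
  classical
  obtain ⟨β, r⟩ := j
  obtain ⟨β', r'⟩ := j'
  unfold dotProduct
  by_cases hββ : β = β'
  · rw [← hββ]
    simp only [Pi.star_apply, star_blockKet_mul_blockKet_same n D p₁ Q hP]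
    rw [← Finset.mul_sum, resid_charSum n D p₁ Q U bk hunit β (r - r'), card_resid_eq n D p₁ Q U β]
    unfold blockConst
    by_cases hrr : r = r'
    · rw [← hrr, if_pos (sub_self r), if_pos rfl]
      push_cast
      ring
    · rw [if_neg (sub_ne_zero.2 hrr), if_neg, mul_zero]
      exact fun h => hrr (Prod.mk.inj h).2
  · simp only [Pi.star_apply, star_blockKet_mul_blockKet_ne n D p₁ Q U bk v' hββ, Finset.sum_const_zero]
    rw [if_neg]
    exact fun h => hββ (Prod.mk.inj h).1

/-- The ROUTING of the read-out: on seeing `(β, r)`, output a uniformly random element of the class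
`r + span(β)`, i.e. `κ(a | β, r) = [r − a ∈ span β]/#span β`. [folklore] -/
noncomputable def classRouting (U : Finset (Fin (n + 1))) (a : ZQ Q) (j : (U → ZQ Q) × ZQ Q) : ℝ := by
  classical
  exact if j.2 - a ∈ span Q j.1 then ((Nat.card (span Q j.1) : ℝ))⁻¹ else 0

/-- `κ ≥ 0`. [folklore] -/
theorem classRouting_nonneg (U : Finset (Fin (n + 1))) (a : ZQ Q) (j : (U → ZQ Q) × ZQ Q) :
    0 ≤ classRouting n Q U a j := by
  unfold classRouting
  split_ifs
  · exact inv_nonneg.2 (Nat.cast_nonneg _)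
  · exact le_rfl

/-- `Σ_a κ(a | j) = 1`. [folklore] -/
theorem sum_classRouting (U : Finset (Fin (n + 1))) (j : (U → ZQ Q) × ZQ Q) :
    ∑ a, classRouting n Q U a j = 1 := by
  classical
  unfold classRouting
  rw [Finset.sum_ite, Finset.sum_const_zero, add_zero, Finset.sum_const, card_class_eq' Q j.1 j.2,
    nsmul_eq_mul, mul_inv_cancel₀]
  exact_mod_cast (card_span_pos Q j.1).ne'

/-- **The general datum read-out** (T13): the routed POVM of the block-twisted kets with the class
routing — "read `ū`; on the block `ū = β` discriminate the `Q` orthogonal twists `w_{β,r}`; output a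
uniform element of `r + span(β)`; off the span guess blindly".  Built from PUBLIC data `(U, bk, v′)` only.
[cite: ChenQuantumLattice2024, §3.5.9 pp. 35–37; NielsenChuang2010, Box 2.3 p. 87] -/
noncomputable def datumReadoutGen (hP : Odd ((p₁ * Q : ℕ+) : ℕ)) (U : Finset (Fin (n + 1)))
    (bk v' : Fin (n + 1) → ℤ) (hunit : ∃ i₀, i₀ ∉ U ∧ IsUnit ((bk i₀ : ℤ) : ZQ Q)) :
    POVM (Fin (n + 1) → ZN D p₁ Q) (ZQ Q) :=
  POVM.ofRouting (blockKet n D p₁ Q U bk v') (blockConst n D p₁ Q U) (blockConst_pos n D p₁ Q U)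
    (blockKet_orth n D p₁ Q hP U bk v' hunit) (classRouting n Q U) (classRouting_nonneg n Q U)
    (sum_classRouting n Q U)

/-- The `p₁`-quotient functional of the unknown coordinates: `ζ(u) = Σ_{i∈U} ((b_i − bk_i)/p₁)·(u_i mod P)`
(eq. (12): `b_i − bk_i ∈ p₁ℤ` on `U`). [cite: ChenQuantumLattice2024, eq. (12) p. 17] -/
def zetaFun (U : Finset (Fin (n + 1))) (bk b : Fin (n + 1) → ℤ) (u : Fin (n + 1) → ZN D p₁ Q) : ZP p₁ Q :=
  ∑ i : U, (((b i - bk i) / ((p₁ : ℕ) : ℤ) : ℤ) : ZP p₁ Q) * toP D (p₁ * Q) (u i)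

/-- `lineFun b = lineFun bk + p₁·ζ` when `b, bk` agree off `U` and are `≡ 0 (mod p₁)` on `U`.
[cite: ChenQuantumLattice2024, eq. (12) p. 17] -/
theorem lineFun_eq_add_p₁_mul_zetaFun (U : Finset (Fin (n + 1))) (bk b : Fin (n + 1) → ℤ)
    (hb : ∀ i ∈ U, ((p₁ : ℕ) : ℤ) ∣ b i) (hbkU : ∀ i ∈ U, ((p₁ : ℕ) : ℤ) ∣ bk i)
    (hbk : ∀ i, i ∉ U → bk i = b i) (u : Fin (n + 1) → ZN D p₁ Q) :
    lineFun n D p₁ Q b u = lineFun n D p₁ Q bk u + ((p₁ : ℕ) : ZP p₁ Q) * zetaFun n D p₁ Q U bk b u := by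
  classical
  unfold lineFun zetaFun
  have h : ∀ i, ((b i : ℤ) : ZP p₁ Q) * toP D (p₁ * Q) (u i)
      = ((bk i : ℤ) : ZP p₁ Q) * toP D (p₁ * Q) (u i)
        + if i ∈ U then ((p₁ : ℕ) : ZP p₁ Q)
            * ((((b i - bk i) / ((p₁ : ℕ) : ℤ) : ℤ) : ZP p₁ Q) * toP D (p₁ * Q) (u i)) else 0 := by
    intro i
    by_cases hi : i ∈ U
    · have hc : ((p₁ : ℕ) : ZP p₁ Q) * ((((b i - bk i) / ((p₁ : ℕ) : ℤ) : ℤ) : ZP p₁ Q))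
          = ((b i : ℤ) : ZP p₁ Q) - ((bk i : ℤ) : ZP p₁ Q) := by
        rw [← Int.cast_natCast (R := ZP p₁ Q) (p₁ : ℕ), ← Int.cast_mul,
          Int.mul_ediv_cancel' (dvd_sub (hb i hi) (hbkU i hi)), Int.cast_sub]
      rw [if_pos hi]
      linear_combination (-(toP D (p₁ * Q) (u i))) * hc
    · rw [if_neg hi, add_zero, hbk i hi]
  simp_rw [h]
  rw [Finset.sum_add_distrib, Finset.sum_ite_mem, Finset.univ_inter, Finset.mul_sum, ← Finset.sum_coe_sort U]

/-- The TWIST SHIFT of a member on the block `β`: `τ(β, s) = Σ_{i∈U}((b_i − bk_i)/p₁ + 2s_i)·β_i ∈ span β`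
— how far the secret shift `s` (and the unknown part of `b`) moves the twist inside the class.
[cite: ChenQuantumLattice2024, §3.5.9 pp. 35–37, eq. (12) p. 17] -/
def twistShift (U : Finset (Fin (n + 1))) (bk b : Fin (n + 1) → ℤ) (β : U → ZQ Q)
    (s : Fin (n + 1) → ZQ Q) : ZQ Q :=
  ∑ i : U, ((((b i - bk i) / ((p₁ : ℕ) : ℤ) : ℤ) : ZQ Q) + 2 * s i) * β i

/-- `2τ(β, s) ∈ span β`, hence `(a − 2τ) − a ∈ span β`. [folklore] -/
theorem sub_two_mul_twistShift_sub_mem (U : Finset (Fin (n + 1))) (bk b : Fin (n + 1) → ℤ) (β : U → ZQ Q)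
    (s : Fin (n + 1) → ZQ Q) (a : ZQ Q) :
    a - 2 * twistShift n p₁ Q U bk b β s - a ∈ span Q β := by
  rw [sub_sub_cancel_left, twistShift, Finset.mul_sum, ← Finset.sum_neg_distrib]
  refine (mem_span_iff Q β _).2 ⟨fun i => -(2 * (((((b i - bk i) / ((p₁ : ℕ) : ℤ) : ℤ)) : ZQ Q) + 2 * s i)), ?_⟩
  exact Finset.sum_congr rfl fun i _ => by ring

/-- `ζ(u) + 2L_s(u) ≡ τ(ū, s) (mod Q)`. [folklore] -/
theorem toQ_zetaFun_add (U : Finset (Fin (n + 1))) (bk b : Fin (n + 1) → ℤ) (s : Fin (n + 1) → ZQ Q)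
    (u : Fin (n + 1) → ZN D p₁ Q) :
    toQ p₁ Q (zetaFun n D p₁ Q U bk b u + 2 * tailLin n D p₁ Q U s u)
      = twistShift n p₁ Q U bk b (resid n D p₁ Q U u) s := by
  rw [map_add, map_mul, map_ofNat, toQ_tailLin, sum_mul_classFreq]
  unfold zetaFun twistShift
  rw [map_sum, Finset.mul_sum, ← Finset.sum_add_distrib]
  refine Finset.sum_congr rfl fun i _ => ?_
  rw [map_mul, map_intCast]
  unfold resid
  ring

/-- `G(t + p₁Y) = G(t)·ψ_Q(2·(t mod Q)·(Y mod Q) + p₁·(Y mod Q)²)` for the line Gauss sum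
(`G(t) = ψ_P(t²)G(0)` and `ψ_P(p₁x) = ψ_Q(x mod Q)`). [cite: Korobov1992, Ch. I §3] -/
theorem lineGauss_add_p₁_mul (t Y : ZP p₁ Q) :
    lineGauss p₁ Q (t + ((p₁ : ℕ) : ZP p₁ Q) * Y)
      = lineGauss p₁ Q t * ZMod.stdAddChar (2 * toQ p₁ Q t * toQ p₁ Q Y + ((p₁ : ℕ) : ZQ Q) * toQ p₁ Q Y ^ 2) := by
  have h2 : (t + ((p₁ : ℕ) : ZP p₁ Q) * Y) ^ 2
      = t ^ 2 + ((p₁ : ℕ) : ZP p₁ Q) * (2 * t * Y + ((p₁ : ℕ) : ZP p₁ Q) * Y ^ 2) := by ring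
  have h3 : toQ p₁ Q (2 * t * Y + ((p₁ : ℕ) : ZP p₁ Q) * Y ^ 2)
      = 2 * toQ p₁ Q t * toQ p₁ Q Y + ((p₁ : ℕ) : ZQ Q) * toQ p₁ Q Y ^ 2 := by
    simp only [map_add, map_mul, map_pow, map_natCast, map_ofNat]
  rw [lineGauss_eq p₁ Q (t + _), lineGauss_eq p₁ Q t, h2, AddChar.map_add_eq_mul, stdAddChar_p₁_mul, h3]
  ring

/-- The BLOCK PHASE of a member: `θ = p₁τ² − Σ_{i∈U} c_i β_i` (a global phase on the block). [folklore] -/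
def blockPhase (U : Finset (Fin (n + 1))) (bk b : Fin (n + 1) → ℤ) (β : U → ZQ Q)
    (sc : (Fin (n + 1) → ZQ Q) × (Fin (n + 1) → ZQ Q)) : ZQ Q :=
  ((p₁ : ℕ) : ZQ Q) * twistShift n p₁ Q U bk b β sc.1 ^ 2 - ∑ i : U, sc.2 i * β i

/-- **Every member is a block-twisted ket on each block** (the mechanism of T13).  For the class member
with datum `a`, secret shift `s` and offset shift `c`, at an outcome `u` with `ū = β`:
`QFT|φ8.(b+2p₁s𝟙_U), v′+d(a,c)⟩(u) = ψ_Q(θ)·w_{β, a − 2τ(β,s)}(u)` — the `c`-part of the class-shift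
character is the constant `ψ_Q(−Σ c_iβ_i)`, the `a`-part is the twist `ψ_Q(−aλ(u))`, and the secret moves
the line functional by `p₁·Y` with `Y ≡ τ (mod Q)`, which twists by `ψ_Q(2τλ(u))` (completing the square);
requires `b ≡ bk` off `U`, `≡ 0 (mod p₁)` on `U` (eq. (12)).
[cite: ChenQuantumLattice2024, §3.5.9 pp. 35–37, eq. (12) p. 17; Korobov1992, Ch. I §3] -/
theorem datumKet_eq_blockKet (U : Finset (Fin (n + 1))) (bk b v' : Fin (n + 1) → ℤ)
    (hb : ∀ i ∈ U, ((p₁ : ℕ) : ℤ) ∣ b i) (hbkU : ∀ i ∈ U, ((p₁ : ℕ) : ℤ) ∣ bk i)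
    (hbk : ∀ i, i ∉ U → bk i = b i) (a : ZQ Q)
    (sc : (Fin (n + 1) → ZQ Q) × (Fin (n + 1) → ZQ Q)) (u : Fin (n + 1) → ZN D p₁ Q) :
    datumKet n D p₁ Q U bk b v' a sc u
      = ZMod.stdAddChar (blockPhase n p₁ Q U bk b (resid n D p₁ Q U u) sc)
        * blockKet n D p₁ Q U bk v'
            (resid n D p₁ Q U u, a - 2 * twistShift n p₁ Q U bk b (resid n D p₁ Q U u) sc.1) u := by
  have hline : lineFun n D p₁ Q (b + secretShift n p₁ Q U sc.1) u
      = lineFun n D p₁ Q bk u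
        + ((p₁ : ℕ) : ZP p₁ Q) * (zetaFun n D p₁ Q U bk b u + 2 * tailLin n D p₁ Q U sc.1 u) := by
    rw [lineFun_add_secretShift, lineFun_eq_add_p₁_mul_zetaFun n D p₁ Q U bk b hb hbkU hbk u]
    ring
  have hchar : (ZMod.stdAddChar (-offsetFun n D p₁ Q (classShift n D p₁ Q U bk a sc.2) u) : ℂ)
      = ZMod.stdAddChar (-(a * toQ p₁ Q (lineFun n D p₁ Q bk u) + ∑ i : U, sc.2 i * resid n D p₁ Q U u i)) := by
    rw [AddChar.map_neg_eq_conj, AddChar.map_neg_eq_conj, stdAddChar_offsetFun_classShift,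
      ← stdAddChar_finset_sum, sum_mul_classFreq, ← AddChar.map_add_eq_mul]
  unfold datumKet blockKet blockPhase
  dsimp only
  rw [if_pos rfl, qft_phi8bKet_eq_lineGauss, qft_phi8bKet_eq_lineGauss, offsetFun_add, neg_add,
    AddChar.map_add_eq_mul, hchar, hline, lineGauss_add_p₁_mul, toQ_zetaFun_add]
  set lam := toQ p₁ Q (lineFun n D p₁ Q bk u) with hlam
  set τ := twistShift n p₁ Q U bk b (resid n D p₁ Q U u) sc.1 with hτ
  set C := ∑ i : U, sc.2 i * resid n D p₁ Q U u i with hC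
  have hAB : (ZMod.stdAddChar (-(a * lam + C)) : ℂ)
        * ZMod.stdAddChar (2 * lam * τ + ((p₁ : ℕ) : ZQ Q) * τ ^ 2)
      = ZMod.stdAddChar (((p₁ : ℕ) : ZQ Q) * τ ^ 2 - C) * ZMod.stdAddChar (-((a - 2 * τ) * lam)) := by
    rw [← AddChar.map_add_eq_mul, ← AddChar.map_add_eq_mul]
    congr 1
    ring
  linear_combination ((ZMod.stdAddChar (-offsetFun n D p₁ Q v' u) : ℂ) * lineGauss p₁ Q (lineFun n D p₁ Q bk u))
    * hAB

/-- `|ψ_Q(x)|² = 1` in the form `conj ψ_Q(x)·ψ_Q(x) = 1`. [folklore] -/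
theorem starRingEnd_stdAddChar_mul_self (x : ZQ Q) :
    (starRingEnd ℂ) (ZMod.stdAddChar x : ℂ) * (ZMod.stdAddChar x : ℂ) = 1 := by
  rw [← AddChar.map_neg_eq_conj, ← AddChar.map_add_eq_mul, neg_add_cancel, AddChar.map_zero_eq_one]

/-- **Overlaps of a member with the system**: `⟨w_{β,r}|member(a,s,c)⟩ = [r = a − 2τ(β,s)]·ψ_Q(θ_β)·c` —
on each block the member is aligned with exactly one twist, which lies in the class `a + span(β)`.
[cite: ChenQuantumLattice2024, §3.5.9 pp. 35–37, eq. (12) p. 17] -/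
theorem blockKet_dot_datumKet (hP : Odd ((p₁ * Q : ℕ+) : ℕ)) (U : Finset (Fin (n + 1)))
    (bk b v' : Fin (n + 1) → ℤ)
    (hb : ∀ i ∈ U, ((p₁ : ℕ) : ℤ) ∣ b i) (hbkU : ∀ i ∈ U, ((p₁ : ℕ) : ℤ) ∣ bk i)
    (hbk : ∀ i, i ∉ U → bk i = b i) (hunit : ∃ i₀, i₀ ∉ U ∧ IsUnit ((bk i₀ : ℤ) : ZQ Q))
    (a : ZQ Q) (sc : (Fin (n + 1) → ZQ Q) × (Fin (n + 1) → ZQ Q)) (j : (U → ZQ Q) × ZQ Q) :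
    star (blockKet n D p₁ Q U bk v' j) ⬝ᵥ datumKet n D p₁ Q U bk b v' a sc
      = if j.2 = a - 2 * twistShift n p₁ Q U bk b j.1 sc.1
        then (ZMod.stdAddChar (blockPhase n p₁ Q U bk b j.1 sc) : ℂ) * ((blockConst n D p₁ Q U : ℝ) : ℂ)
        else 0 := by
  classical
  obtain ⟨β, r⟩ := j
  have h : star (blockKet n D p₁ Q U bk v' (β, r)) ⬝ᵥ datumKet n D p₁ Q U bk b v' a sc
      = (ZMod.stdAddChar (blockPhase n p₁ Q U bk b β sc) : ℂ)
        * (star (blockKet n D p₁ Q U bk v' (β, r))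
            ⬝ᵥ blockKet n D p₁ Q U bk v' (β, a - 2 * twistShift n p₁ Q U bk b β sc.1)) := by
    unfold dotProduct
    rw [Finset.mul_sum]
    refine Finset.sum_congr rfl fun u _ => ?_
    by_cases hu : resid n D p₁ Q U u = β
    · rw [Pi.star_apply, datumKet_eq_blockKet n D p₁ Q U bk b v' hb hbkU hbk a sc u, hu]
      ring
    · simp only [Pi.star_apply, blockKet, if_neg hu, star_zero, zero_mul, mul_zero]
  rw [h, blockKet_orth n D p₁ Q hP U bk v' hunit]
  dsimp only
  by_cases hr : r = a - 2 * twistShift n p₁ Q U bk b β sc.1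
  · subst hr
    rw [if_pos rfl, if_pos rfl]
  · rw [if_neg hr, if_neg, mul_zero]
    exact fun h => hr (Prod.mk.inj h).2

/-- **T13 (the general datum read-out attains the value on EVERY member).**  For odd `P`, `b ≡ bk` off
`U`, `b ≡ bk ≡ 0 (mod p₁)` on `U`, and a unit coordinate `bk_{i₀}`, `i₀ ∉ U`: for EVERY datum `a`, secret
shift `s` and offset shift `c`, the general datum read-out outputs `a` on the member `(a,(s,c))` with Born
weight EXACTLY `V(Q, m)·P·N^{n+1}`, `V(Q,m) = Q^{-m}Σ_β 1/#span(β)` — the same on every instance.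
[cite: ChenQuantumLattice2024, §3.5.9 pp. 35–37, eq. (12) p. 17; NielsenChuang2010, Box 2.3 p. 87] -/
theorem datumReadoutGen_weight (hP : Odd ((p₁ * Q : ℕ+) : ℕ)) (U : Finset (Fin (n + 1)))
    (bk b v' : Fin (n + 1) → ℤ)
    (hb : ∀ i ∈ U, ((p₁ : ℕ) : ℤ) ∣ b i) (hbkU : ∀ i ∈ U, ((p₁ : ℕ) : ℤ) ∣ bk i)
    (hbk : ∀ i, i ∉ U → bk i = b i) (hunit : ∃ i₀, i₀ ∉ U ∧ IsUnit ((bk i₀ : ℤ) : ZQ Q))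
    (a : ZQ Q) (sc : (Fin (n + 1) → ZQ Q) × (Fin (n + 1) → ZQ Q)) :
    (datumReadoutGen n D p₁ Q hP U bk v' hunit).weight (datumKet n D p₁ Q U bk b v' a sc) a
      = (((datumValue Q U)
          * ((((p₁ * Q : ℕ+) : ℕ) : ℝ) * (((D * D * (p₁ * Q) : ℕ+) : ℕ) : ℝ) ^ (n + 1)) : ℝ) : ℂ) := by
  classical
  have hQ : (0 : ℝ) < ((Q : ℕ+) : ℕ) := by exact_mod_cast PNat.pos Q
  -- the selected indices `(β, a − 2τ(β))`, one per block
  have hsel : (Finset.univ.filter fun j : (U → ZQ Q) × ZQ Q =>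
        j.2 = a - 2 * twistShift n p₁ Q U bk b j.1 sc.1).card = Fintype.card (U → ZQ Q) := by
    rw [← Fintype.card_subtype]
    exact Fintype.card_congr
      { toFun := fun j => j.1.1
        invFun := fun β => ⟨(β, a - 2 * twistShift n p₁ Q U bk b β sc.1), rfl⟩
        left_inv := fun j => Subtype.ext (Prod.ext rfl j.2.symm)
        right_inv := fun β => rfl }
  have hQm : ((Fintype.card (U → ZQ Q) : ℕ) : ℂ) = ((((Q : ℕ+) : ℕ) : ℂ)) ^ U.card := by
    rw [Fintype.card_fun, ZMod.card, Fintype.card_coe, Nat.cast_pow]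
  have hB := card_resid_mul n D p₁ Q U 0
  have hBc : ((Nat.card {u : Fin (n + 1) → ZN D p₁ Q // resid n D p₁ Q U u = 0} : ℕ) : ℂ)
      * ((((Q : ℕ+) : ℕ) : ℂ)) ^ U.card = ((((D * D * (p₁ * Q) : ℕ+) : ℕ) : ℂ)) ^ (n + 1) := by
    exact_mod_cast hB
  have hBr : ((Nat.card {u : Fin (n + 1) → ZN D p₁ Q // resid n D p₁ Q U u = 0} : ℕ) : ℝ)
      * ((((Q : ℕ+) : ℕ) : ℝ)) ^ U.card = ((((D * D * (p₁ * Q) : ℕ+) : ℕ) : ℝ)) ^ (n + 1) := by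
    exact_mod_cast hB
  have hnorm : star (datumKet n D p₁ Q U bk b v' a sc) ⬝ᵥ datumKet n D p₁ Q U bk b v' a sc
      = ((blockConst n D p₁ Q U : ℝ) : ℂ)
        * ((Finset.univ.filter fun j : (U → ZQ Q) × ZQ Q =>
            j.2 = a - 2 * twistShift n p₁ Q U bk b j.1 sc.1).card : ℂ) := by
    push_cast at hBc
    rw [datumKet_normSq n D p₁ Q hP, hsel, hQm, blockConst]
    push_cast
    linear_combination (-((((p₁ : ℕ+) : ℕ) : ℂ) * (((Q : ℕ+) : ℕ) : ℂ))) * hBc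
  unfold datumReadoutGen
  rw [POVM.ofRouting_weight_of_aligned (blockConst_pos n D p₁ Q U) (blockKet_orth n D p₁ Q hP U bk v' hunit)
      (classRouting n Q U) (classRouting_nonneg n Q U) (sum_classRouting n Q U)
      (fun j : (U → ZQ Q) × ZQ Q => j.2 = a - 2 * twistShift n p₁ Q U bk b j.1 sc.1)
      (fun j => (ZMod.stdAddChar (blockPhase n p₁ Q U bk b j.1 sc) : ℂ))
      (fun j => starRingEnd_stdAddChar_mul_self Q _)
      (fun j => blockKet_dot_datumKet n D p₁ Q hP U bk b v' hb hbkU hbk hunit a sc j) hnorm]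
  -- the selected coefficients: `κ(a | β, a − 2τ) = 1/#span β` since `2τ ∈ span β`
  have hκ : ∀ β : U → ZQ Q, classRouting n Q U a (β, a - 2 * twistShift n p₁ Q U bk b β sc.1)
      = ((Nat.card (span Q β) : ℝ))⁻¹ := by
    intro β
    unfold classRouting
    dsimp only
    rw [if_pos (sub_two_mul_twistShift_sub_mem n p₁ Q U bk b β sc.1 a)]
  have hsum : ∑ j ∈ Finset.univ.filter (fun j : (U → ZQ Q) × ZQ Q =>
        j.2 = a - 2 * twistShift n p₁ Q U bk b j.1 sc.1), ((classRouting n Q U a j : ℝ) : ℂ)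
      = ∑ β : U → ZQ Q, ((((Nat.card (span Q β) : ℝ))⁻¹ : ℝ) : ℂ) := by
    rw [Finset.sum_filter, Fintype.sum_prod_type]
    refine Finset.sum_congr rfl fun β _ => ?_
    simp only
    rw [Finset.sum_ite_eq' Finset.univ (a - 2 * twistShift n p₁ Q U bk b β sc.1), if_pos (Finset.mem_univ _),
      hκ β]
  have hval : datumValue Q U * ((((p₁ * Q : ℕ+) : ℕ) : ℝ) * (((D * D * (p₁ * Q) : ℕ+) : ℕ) : ℝ) ^ (n + 1))
      = blockConst n D p₁ Q U * ∑ β : U → ZQ Q, ((Nat.card (span Q β) : ℝ))⁻¹ := by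
    unfold datumValue blockConst
    rw [Fintype.card_coe, ← hBr, div_mul_eq_mul_div, div_eq_iff (pow_ne_zero _ hQ.ne')]
    ring
  rw [hsum, hval, Complex.ofReal_mul, Complex.ofReal_sum]

/-! ### 5. Probability form; the exact optimum for every `Q` -/

/-- **T13 (probability form).**  With datum, secret shift and offset shift uniform, the general datum
read-out guesses the datum correctly with probability EXACTLY `V(Q, m)`.
[cite: ChenQuantumLattice2024, §3.5.9 pp. 35–37] -/
theorem datum_success_prob_eq_value (hP : Odd ((p₁ * Q : ℕ+) : ℕ)) (U : Finset (Fin (n + 1)))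
    (bk b v' : Fin (n + 1) → ℤ)
    (hb : ∀ i ∈ U, ((p₁ : ℕ) : ℤ) ∣ b i) (hbkU : ∀ i ∈ U, ((p₁ : ℕ) : ℤ) ∣ bk i)
    (hbk : ∀ i, i ∉ U → bk i = b i) (hunit : ∃ i₀, i₀ ∉ U ∧ IsUnit ((bk i₀ : ℤ) : ZQ Q)) :
    (∑ a, ∑ sc, (datumReadoutGen n D p₁ Q hP U bk v' hunit).weight (datumKet n D p₁ Q U bk b v' a sc) a).re
        / (∑ a : ZQ Q, ∑ sc,
            star (datumKet n D p₁ Q U bk b v' a sc) ⬝ᵥ datumKet n D p₁ Q U bk b v' a sc).re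
      = datumValue Q U := by
  simp only [datumReadoutGen_weight n D p₁ Q hP U bk b v' hb hbkU hbk hunit]
  rw [Finset.sum_const, Finset.card_univ, Finset.sum_const, Finset.card_univ, smul_smul, nsmul_eq_mul,
    ← Complex.ofReal_natCast, ← Complex.ofReal_mul, Complex.ofReal_re, datum_totalWeight n D p₁ Q hP,
    Complex.natCast_re]
  simp only [Fintype.card_prod, Fintype.card_fun, ZMod.card, Fintype.card_fin]
  have hQ : (0 : ℝ) < ((Q : ℕ+) : ℕ) := by exact_mod_cast PNat.pos Q
  have hP' : (0 : ℝ) < ((p₁ * Q : ℕ+) : ℕ) := by exact_mod_cast PNat.pos _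
  have hN : (0 : ℝ) < ((D * D * (p₁ * Q) : ℕ+) : ℕ) := by exact_mod_cast PNat.pos _
  rw [div_eq_iff (by positivity)]
  push_cast
  ring

/-- **T13: the exact optimum, every `Q`.**  `V(Q, m) = Q^{-m}·Σ_{β ∈ ℤ_Q^U} 1/#span(β)` is the GREATEST
class success probability over ALL POVMs on the Step-9 register (attained: the general datum read-out;
upper bound: `datum_success_prob_le_value`) — the Bayes value, for prime AND composite `Q`.
[cite: ChenQuantumLattice2024, §3.5.9 pp. 35–37; NielsenChuang2010, Box 2.3 p. 87] -/
theorem datum_success_prob_isGreatest (hP : Odd ((p₁ * Q : ℕ+) : ℕ)) (U : Finset (Fin (n + 1)))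
    (bk b v' : Fin (n + 1) → ℤ)
    (hb : ∀ i ∈ U, ((p₁ : ℕ) : ℤ) ∣ b i) (hbkU : ∀ i ∈ U, ((p₁ : ℕ) : ℤ) ∣ bk i)
    (hbk : ∀ i, i ∉ U → bk i = b i) (hunit : ∃ i₀, i₀ ∉ U ∧ IsUnit ((bk i₀ : ℤ) : ZQ Q)) :
    IsGreatest (Set.range fun E : POVM (Fin (n + 1) → ZN D p₁ Q) (ZQ Q) =>
        (∑ a, ∑ sc, E.weight (datumKet n D p₁ Q U bk b v' a sc) a).re
          / (∑ a : ZQ Q, ∑ sc,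
              star (datumKet n D p₁ Q U bk b v' a sc) ⬝ᵥ datumKet n D p₁ Q U bk b v' a sc).re)
      (datumValue Q U) := by
  refine ⟨⟨datumReadoutGen n D p₁ Q hP U bk v' hunit,
    datum_success_prob_eq_value n D p₁ Q hP U bk b v' hb hbkU hbk hunit⟩, ?_⟩
  rintro _ ⟨E, rfl⟩
  exact datum_success_prob_le_value n D p₁ Q hP U bk b v' hbk E

/-- **T13, minimax (worst case over the class).**  No measurement outputs the datum with Born weight above
`V·P·N^{n+1}` on EVERY member (some member is at most the average), and the general datum read-out
achieves exactly `V·P·N^{n+1}` on every member: the worst-case value over all POVMs is `V(Q, m)` too.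
[cite: ChenQuantumLattice2024, §3.5.9 pp. 35–37] -/
theorem datum_minimax (hP : Odd ((p₁ * Q : ℕ+) : ℕ)) (U : Finset (Fin (n + 1)))
    (bk b v' : Fin (n + 1) → ℤ)
    (hb : ∀ i ∈ U, ((p₁ : ℕ) : ℤ) ∣ b i) (hbkU : ∀ i ∈ U, ((p₁ : ℕ) : ℤ) ∣ bk i)
    (hbk : ∀ i, i ∉ U → bk i = b i) (hunit : ∃ i₀, i₀ ∉ U ∧ IsUnit ((bk i₀ : ℤ) : ZQ Q)) :
    (∀ E : POVM (Fin (n + 1) → ZN D p₁ Q) (ZQ Q), ∃ a : ZQ Q,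
        ∃ sc : (Fin (n + 1) → ZQ Q) × (Fin (n + 1) → ZQ Q),
          (E.weight (datumKet n D p₁ Q U bk b v' a sc) a).re
            ≤ datumValue Q U
              * ((((p₁ * Q : ℕ+) : ℕ) : ℝ) * (((D * D * (p₁ * Q) : ℕ+) : ℕ) : ℝ) ^ (n + 1)))
    ∧ (∀ a : ZQ Q, ∀ sc : (Fin (n + 1) → ZQ Q) × (Fin (n + 1) → ZQ Q),
        ((datumReadoutGen n D p₁ Q hP U bk v' hunit).weight (datumKet n D p₁ Q U bk b v' a sc) a).re
          = datumValue Q U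
              * ((((p₁ * Q : ℕ+) : ℕ) : ℝ) * (((D * D * (p₁ * Q) : ℕ+) : ℕ) : ℝ) ^ (n + 1))) := by
  classical
  refine ⟨fun E => ?_, fun a sc => ?_⟩
  · have hQ : (0 : ℝ) < ((Q : ℕ+) : ℕ) := by exact_mod_cast PNat.pos Q
    have hP' : (0 : ℝ) < ((p₁ * Q : ℕ+) : ℕ) := by exact_mod_cast PNat.pos _
    have hN : (0 : ℝ) < ((D * D * (p₁ * Q) : ℕ+) : ℕ) := by exact_mod_cast PNat.pos _
    have hle := datum_success_prob_le_value n D p₁ Q hP U bk b v' hbk E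
    have hden : (∑ a : ZQ Q, ∑ sc, star (datumKet n D p₁ Q U bk b v' a sc)
        ⬝ᵥ datumKet n D p₁ Q U bk b v' a sc).re
          = (((Q : ℕ+) : ℕ) : ℝ) * ((((Q : ℕ+) : ℕ) : ℝ) ^ (n + 1) * (((Q : ℕ+) : ℕ) : ℝ) ^ (n + 1))
            * ((((p₁ * Q : ℕ+) : ℕ) : ℝ) * (((D * D * (p₁ * Q) : ℕ+) : ℕ) : ℝ) ^ (n + 1)) := by
      rw [datum_totalWeight n D p₁ Q hP, Complex.natCast_re]
      push_cast
      ring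
    rw [hden, div_le_iff₀ (by positivity)] at hle
    by_contra hcon
    push Not at hcon
    refine absurd hle (not_le.2 ?_)
    simp only [Complex.re_sum]
    calc datumValue Q U
            * ((((Q : ℕ+) : ℕ) : ℝ) * ((((Q : ℕ+) : ℕ) : ℝ) ^ (n + 1) * (((Q : ℕ+) : ℕ) : ℝ) ^ (n + 1))
            * ((((p₁ * Q : ℕ+) : ℕ) : ℝ) * (((D * D * (p₁ * Q) : ℕ+) : ℕ) : ℝ) ^ (n + 1)))
        = ∑ _a : ZQ Q, ∑ _sc : (Fin (n + 1) → ZQ Q) × (Fin (n + 1) → ZQ Q), datumValue Q U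
            * ((((p₁ * Q : ℕ+) : ℕ) : ℝ) * (((D * D * (p₁ * Q) : ℕ+) : ℕ) : ℝ) ^ (n + 1)) := by
          rw [Finset.sum_const, Finset.card_univ, Finset.sum_const, Finset.card_univ, smul_smul, nsmul_eq_mul]
          simp only [Fintype.card_prod, Fintype.card_fun, ZMod.card, Fintype.card_fin]
          push_cast
          ring
      _ < ∑ a : ZQ Q, ∑ sc : (Fin (n + 1) → ZQ Q) × (Fin (n + 1) → ZQ Q),
            (E.weight (datumKet n D p₁ Q U bk b v' a sc) a).re :=
          Finset.sum_lt_sum_of_nonempty Finset.univ_nonempty fun a _ =>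
            Finset.sum_lt_sum_of_nonempty Finset.univ_nonempty fun sc _ => hcon a sc
  · rw [datumReadoutGen_weight n D p₁ Q hP U bk b v' hb hbkU hbk hunit, Complex.ofReal_re]

/-- **T13 recovers T12 for prime `Q`.**  The optimum `V(Q, #U)` equals `1/Q + (1 − 1/Q)/Q^{#U}`.
[cite: ChenQuantumLattice2024, §3.5.9 pp. 35–37] -/
theorem datumValue_finset_of_prime [Fact (Nat.Prime ((Q : ℕ+) : ℕ))] (U : Finset (Fin (n + 1))) :
    datumValue Q U = 1 / ((Q : ℕ+) : ℕ) + (1 - 1 / ((Q : ℕ+) : ℕ)) / (((Q : ℕ+) : ℕ) : ℝ) ^ U.card := by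
  rw [datumValue_of_prime, Fintype.card_coe]

end Readout

/-! ### 6. Duality: the value in closed form (`#span(β)·#ann(β) = Q`) -/

section Duality

variable (Q : ℕ+) {ι : Type*} [Fintype ι] [DecidableEq ι]

/-- The double character sum `S(β) = Σ_σ Σ_c ψ_Q(σ·Σ_i c_iβ_i)` counts the ANNIHILATOR of `β`:
`S(β) = Q^{#ι}·#{σ ∈ ℤ_Q : σβ_i = 0 ∀ i}` (orthogonality in each coordinate `c_i`).
[cite: Korobov1992, Ch. I §1 (orthogonality of characters)] -/
theorem charSum_eq_card_ann (β : ι → ZQ Q) :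
    ∑ σ : ZQ Q, ∑ c : ι → ZQ Q, (ZMod.stdAddChar (σ * ∑ i, c i * β i) : ℂ)
      = ((((Q : ℕ+) : ℕ) : ℂ)) ^ Fintype.card ι * (Nat.card {σ : ZQ Q // ∀ i, σ * β i = 0} : ℂ) := by
  have hinner : ∀ σ : ZQ Q, ∑ c : ι → ZQ Q, (ZMod.stdAddChar (σ * ∑ i, c i * β i) : ℂ)
      = if ∀ i, σ * β i = 0 then ((((Q : ℕ+) : ℕ) : ℂ)) ^ Fintype.card ι else 0 := by
    intro σ
    have h1 : ∀ c : ι → ZQ Q, (ZMod.stdAddChar (σ * ∑ i, c i * β i) : ℂ)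
        = ∏ i, (ZMod.stdAddChar (c i * (σ * β i)) : ℂ) := by
      intro c
      rw [Finset.mul_sum, Finset.sum_congr rfl fun i _ => mul_left_comm σ (c i) (β i), stdAddChar_finset_sum]
    have h2 : ∀ i, ∑ x : ZQ Q, (ZMod.stdAddChar (x * (σ * β i)) : ℂ)
        = if σ * β i = 0 then (((Q : ℕ+) : ℕ) : ℂ) else 0 := by
      intro i
      rw [AddChar.sum_mulShift _ (ZMod.isPrimitive_stdAddChar _), ZMod.card, Nat.cast_ite, Nat.cast_zero]
    simp_rw [h1]
    rw [← Fintype.prod_sum fun i x => (ZMod.stdAddChar (x * (σ * β i)) : ℂ)]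
    simp_rw [h2]
    split_ifs with hall
    · rw [Finset.prod_congr rfl fun i _ => if_pos (hall i), Finset.prod_const, Finset.card_univ]
    · push Not at hall
      obtain ⟨i, hi⟩ := hall
      exact Finset.prod_eq_zero (Finset.mem_univ i) (if_neg hi)
  simp_rw [hinner]
  rw [← Finset.sum_filter, Finset.sum_const, nsmul_eq_mul, mul_comm, Nat.card_eq_fintype_card,
    Fintype.card_subtype]

/-- The same double sum, summed the other way, counts the KERNEL of `c ↦ Σ c_iβ_i`:
`S(β) = Q·#{c : Σ_i c_iβ_i = 0}` (orthogonality in `σ`). [cite: Korobov1992, Ch. I §1] -/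
theorem charSum_eq_card_ker (β : ι → ZQ Q) :
    ∑ σ : ZQ Q, ∑ c : ι → ZQ Q, (ZMod.stdAddChar (σ * ∑ i, c i * β i) : ℂ)
      = (((Q : ℕ+) : ℕ) : ℂ) * (Nat.card {c : ι → ZQ Q // ∑ i, c i * β i = 0} : ℂ) := by
  have h2 : ∀ c : ι → ZQ Q, ∑ σ : ZQ Q, (ZMod.stdAddChar (σ * ∑ i, c i * β i) : ℂ)
      = if ∑ i, c i * β i = 0 then (((Q : ℕ+) : ℕ) : ℂ) else 0 := by
    intro c
    rw [AddChar.sum_mulShift _ (ZMod.isPrimitive_stdAddChar _), ZMod.card, Nat.cast_ite, Nat.cast_zero]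
  rw [Finset.sum_comm]
  simp_rw [h2]
  rw [← Finset.sum_filter, Finset.sum_const, nsmul_eq_mul, mul_comm, Nat.card_eq_fintype_card,
    Fintype.card_subtype]

/-- First isomorphism theorem, counted: `#span(β)·#ker = Q^{#ι}`. [folklore] -/
theorem card_span_mul_card_ker (β : ι → ZQ Q) :
    Nat.card (span Q β) * Nat.card {c : ι → ZQ Q // ∑ i, c i * β i = 0} = ((Q : ℕ+) : ℕ) ^ Fintype.card ι := by
  have hker : Nat.card (linComb Q β).ker = Nat.card {c : ι → ZQ Q // ∑ i, c i * β i = 0} :=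
    Nat.card_congr (Equiv.subtypeEquivRight fun c => (linComb Q β).mem_ker)
  rw [← hker, span, ← Nat.card_congr (QuotientAddGroup.quotientKerEquivRange (linComb Q β)).toEquiv,
    ← AddSubgroup.card_eq_card_quotient_mul_card_addSubgroup, Nat.card_eq_fintype_card, Fintype.card_fun,
    ZMod.card]

/-- **Duality in `ℤ_Q`**: `#span(β)·#ann(β) = Q`, `ann(β) = {σ : σβ_i = 0 ∀ i}` (`#ann(β) = gcd(β, Q)`,
`#span(β) = Q/gcd(β, Q)`) — the double sum `S(β)` computed two ways. [folklore] -/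
theorem card_span_mul_card_ann (β : ι → ZQ Q) :
    Nat.card (span Q β) * Nat.card {σ : ZQ Q // ∀ i, σ * β i = 0} = ((Q : ℕ+) : ℕ) := by
  have hQm : 0 < ((Q : ℕ+) : ℕ) ^ Fintype.card ι := pow_pos (PNat.pos Q) _
  have hAB : ((Q : ℕ+) : ℕ) ^ Fintype.card ι * Nat.card {σ : ZQ Q // ∀ i, σ * β i = 0}
      = ((Q : ℕ+) : ℕ) * Nat.card {c : ι → ZQ Q // ∑ i, c i * β i = 0} := by
    have h := (charSum_eq_card_ann Q β).symm.trans (charSum_eq_card_ker Q β)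
    exact_mod_cast h
  refine Nat.eq_of_mul_eq_mul_left hQm ?_
  calc ((Q : ℕ+) : ℕ) ^ Fintype.card ι * (Nat.card (span Q β) * Nat.card {σ : ZQ Q // ∀ i, σ * β i = 0})
      = Nat.card (span Q β) * (((Q : ℕ+) : ℕ) ^ Fintype.card ι * Nat.card {σ : ZQ Q // ∀ i, σ * β i = 0}) := by
        ring
    _ = Nat.card (span Q β) * (((Q : ℕ+) : ℕ) * Nat.card {c : ι → ZQ Q // ∑ i, c i * β i = 0}) := by
        rw [hAB]
    _ = ((Q : ℕ+) : ℕ) * (Nat.card (span Q β) * Nat.card {c : ι → ZQ Q // ∑ i, c i * β i = 0}) := by ring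
    _ = ((Q : ℕ+) : ℕ) ^ Fintype.card ι * ((Q : ℕ+) : ℕ) := by
        rw [card_span_mul_card_ker, mul_comm]

variable (ι) in
/-- **The value in closed form (annihilators)**: `V(Q, ι) = Q^{-(#ι+1)}·Σ_β #ann(β)`, i.e.
`V = (1/Q)·E_β[gcd(β, Q)]` — T10's slogan "`1/Q·E[gcd]`" made exact (the T10 BOUND was
`1/Q + (1 − 1/Q)·Pr[β annihilated by a non-zero σ]`). [cite: ChenQuantumLattice2024, §3.5.9 pp. 35–37] -/
theorem datumValue_eq_sum_card_ann :
    datumValue Q ι = (∑ β : ι → ZQ Q, (Nat.card {σ : ZQ Q // ∀ i, σ * β i = 0} : ℝ))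
      / (((Q : ℕ+) : ℕ) : ℝ) ^ (Fintype.card ι + 1) := by
  have hQ : (0 : ℝ) < ((Q : ℕ+) : ℕ) := by exact_mod_cast PNat.pos Q
  unfold datumValue
  rw [pow_succ', ← div_div]
  congr 1
  rw [Finset.sum_div]
  refine Finset.sum_congr rfl fun β _ => ?_
  have hr : (Nat.card (span Q β) : ℝ) * (Nat.card {σ : ZQ Q // ∀ i, σ * β i = 0} : ℝ) = ((Q : ℕ+) : ℕ) := by
    exact_mod_cast card_span_mul_card_ann Q β
  have hs : (Nat.card (span Q β) : ℝ) ≠ 0 := by exact_mod_cast (card_span_pos Q β).ne'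
  rw [eq_div_iff hQ.ne', ← hr, inv_mul_cancel_left₀ hs]

variable (ι) in
/-- **The value in closed form (one sum over `ℤ_Q`)**: `V(Q, ι) = Q^{-(#ι+1)}·Σ_{σ ∈ ℤ_Q} #{x : σx = 0}^{#ι}`
`= Q^{-(#ι+1)}·Σ_σ gcd(σ, Q)^{#ι} = Q^{-(#ι+1)}·Σ_{d ∣ Q} φ(Q/d)·d^{#ι}` (double counting the pairs
`(β, σ)` with `σβ = 0`).  E.g. `Q = 15`, `#ι = 1`: `V = (15 + 2·5 + 4·3 + 8·1)/225 = 1/5`. [folklore] -/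
theorem datumValue_eq_sum_pow :
    datumValue Q ι = (∑ σ : ZQ Q, ((Nat.card {x : ZQ Q // σ * x = 0} : ℝ)) ^ Fintype.card ι)
      / (((Q : ℕ+) : ℕ) : ℝ) ^ (Fintype.card ι + 1) := by
  rw [datumValue_eq_sum_card_ann]
  congr 1
  have h1 : ∀ β : ι → ZQ Q, (Nat.card {σ : ZQ Q // ∀ i, σ * β i = 0} : ℝ)
      = ∑ σ : ZQ Q, if ∀ i, σ * β i = 0 then (1 : ℝ) else 0 := by
    intro β
    rw [Finset.sum_boole, Nat.card_eq_fintype_card, Fintype.card_subtype]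
  have h2 : ∀ σ : ZQ Q, (∑ β : ι → ZQ Q, if ∀ i, σ * β i = 0 then (1 : ℝ) else 0)
      = ((Nat.card {x : ZQ Q // σ * x = 0} : ℝ)) ^ Fintype.card ι := by
    intro σ
    rw [Finset.sum_boole, ← Fintype.card_subtype, ← Nat.card_eq_fintype_card,
      Nat.card_congr (@Equiv.subtypePiEquivPi ι (fun _ => ZQ Q) (fun _ x => σ * x = 0)), Nat.card_pi,
      Finset.prod_const, Finset.card_univ, Nat.cast_pow]
  calc ∑ β : ι → ZQ Q, (Nat.card {σ : ZQ Q // ∀ i, σ * β i = 0} : ℝ)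
      = ∑ β : ι → ZQ Q, ∑ σ : ZQ Q, (if ∀ i, σ * β i = 0 then (1 : ℝ) else 0) :=
        Finset.sum_congr rfl fun β _ => h1 β
    _ = ∑ σ : ZQ Q, ∑ β : ι → ZQ Q, (if ∀ i, σ * β i = 0 then (1 : ℝ) else 0) := Finset.sum_comm
    _ = ∑ σ : ZQ Q, ((Nat.card {x : ZQ Q // σ * x = 0} : ℝ)) ^ Fintype.card ι :=
        Finset.sum_congr rfl fun σ _ => h2 σ

end Duality

end Literature.Computability.Cryptography.Chen2024

/-! ### The `Steps` rendering: T13 for every admissible shape -/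

namespace Literature.Computability.Cryptography.Chen2024.Shape

open scoped BigOperators ComplexOrder
open Matrix

variable (S : Shape)

/-- **T13 for every admissible shape (attainment).**  Let `U ∌ 0` be the unknown coordinates, `bk` any
PUBLIC vector agreeing with `S.b` off `U` and `≡ 0 (mod p₁)` on `U`, `v′` any representative of the offset
class.  The general datum read-out built from `(U, bk, v′)` outputs the datum `a` on EVERY member
`(a, (s, c))` of the class with Born weight exactly `V(Q, #U)·P·N^{n+1}`.
[cite: ChenQuantumLattice2024, §3.5.9 pp. 35–37, eq. (12) p. 17, Cond. C.3 p. 18] -/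
theorem datum_privacy_optimum_attained (h : S.Admissible) (U : Finset (Fin (S.n + 1)))
    (hU : (0 : Fin (S.n + 1)) ∉ U) (bk : Fin (S.n + 1) → ℤ)
    (hbkU : ∀ i ∈ U, ((S.p₁ : ℕ) : ℤ) ∣ bk i) (hbk : ∀ i, i ∉ U → bk i = S.b i)
    (v' : Fin (S.n + 1) → ℤ) (a : ZQ S.Q) (sc : (Fin (S.n + 1) → ZQ S.Q) × (Fin (S.n + 1) → ZQ S.Q)) :
    (datumReadoutGen S.n S.D S.p₁ S.Q h.odd_P U bk v' (h.exists_unit_coord hU hbk)).weight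
        (datumKet S.n S.D S.p₁ S.Q U bk S.b v' a sc) a
      = (((datumValue S.Q U) * (((S.P : ℕ) : ℝ) * ((S.N : ℕ) : ℝ) ^ (S.n + 1)) : ℝ) : ℂ) :=
  datumReadoutGen_weight S.n S.D S.p₁ S.Q h.odd_P U bk S.b v' (h.p₁_dvd_of_mem hU) hbkU hbk
    (h.exists_unit_coord hU hbk) a sc

/-- **T13 for every admissible shape (the exact optimum, every `Q`).**  `V(Q, #U)` is the greatest class
success probability over ALL measurements of the Step-9 register (`U ∌ 0`, `bk` public as above) — for the
composite `Q = (c+1)‖b‖²/p₁` of Chen's algorithm as well as for prime `Q`.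
[cite: ChenQuantumLattice2024, §3.5.9 pp. 35–37, eq. (12) p. 17, Cond. C.3–C.5 p. 18] -/
theorem datum_privacy_optimum (h : S.Admissible) (U : Finset (Fin (S.n + 1)))
    (hU : (0 : Fin (S.n + 1)) ∉ U) (bk : Fin (S.n + 1) → ℤ)
    (hbkU : ∀ i ∈ U, ((S.p₁ : ℕ) : ℤ) ∣ bk i) (hbk : ∀ i, i ∉ U → bk i = S.b i)
    (v' : Fin (S.n + 1) → ℤ) :
    IsGreatest (Set.range fun E : POVM (Fin (S.n + 1) → ZN S.D S.p₁ S.Q) (ZQ S.Q) =>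
        (∑ a, ∑ sc, E.weight (datumKet S.n S.D S.p₁ S.Q U bk S.b v' a sc) a).re
          / (∑ a : ZQ S.Q, ∑ sc, star (datumKet S.n S.D S.p₁ S.Q U bk S.b v' a sc)
              ⬝ᵥ datumKet S.n S.D S.p₁ S.Q U bk S.b v' a sc).re)
      (datumValue S.Q U) :=
  datum_success_prob_isGreatest S.n S.D S.p₁ S.Q h.odd_P U bk S.b v' (h.p₁_dvd_of_mem hU) hbkU hbk
    (h.exists_unit_coord hU hbk)

/-- **The worst-case form for every admissible shape.**  No measurement exceeds `V(Q,#U)·P·N^{n+1}` on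
every member of the class, and the general datum read-out achieves it on every member.
[cite: ChenQuantumLattice2024, §3.5.9 pp. 35–37, Cond. C.3 p. 18] -/
theorem datum_privacy_minimax (h : S.Admissible) (U : Finset (Fin (S.n + 1)))
    (hU : (0 : Fin (S.n + 1)) ∉ U) (bk : Fin (S.n + 1) → ℤ)
    (hbkU : ∀ i ∈ U, ((S.p₁ : ℕ) : ℤ) ∣ bk i) (hbk : ∀ i, i ∉ U → bk i = S.b i)
    (v' : Fin (S.n + 1) → ℤ) :
    (∀ E : POVM (Fin (S.n + 1) → ZN S.D S.p₁ S.Q) (ZQ S.Q), ∃ a : ZQ S.Q,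
        ∃ sc : (Fin (S.n + 1) → ZQ S.Q) × (Fin (S.n + 1) → ZQ S.Q),
          (E.weight (datumKet S.n S.D S.p₁ S.Q U bk S.b v' a sc) a).re
            ≤ datumValue S.Q U * (((S.P : ℕ) : ℝ) * ((S.N : ℕ) : ℝ) ^ (S.n + 1)))
    ∧ (∀ a : ZQ S.Q, ∀ sc : (Fin (S.n + 1) → ZQ S.Q) × (Fin (S.n + 1) → ZQ S.Q),
        ((datumReadoutGen S.n S.D S.p₁ S.Q h.odd_P U bk v' (h.exists_unit_coord hU hbk)).weight
            (datumKet S.n S.D S.p₁ S.Q U bk S.b v' a sc) a).re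
          = datumValue S.Q U * (((S.P : ℕ) : ℝ) * ((S.N : ℕ) : ℝ) ^ (S.n + 1))) :=
  datum_minimax S.n S.D S.p₁ S.Q h.odd_P U bk S.b v' (h.p₁_dvd_of_mem hU) hbkU hbk (h.exists_unit_coord hU hbk)

end Literature.Computability.Cryptography.Chen2024.Shape
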